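import Mathlib
import Literature.MathematicalPhysics.QuantumLattice.YangMillsClassical
import Literature.MathematicalPhysics.QuantumLattice.GaugeGroups
import Literature.MathematicalPhysics.QuantumFieldTheory.StrongCouplingActivities
import HarnessLib

/-!
# The Cayley chart of `U(N)` and Haar measure near the identity

Infrastructure for the weak-coupling (`β → ∞`) analysis of `U(N)` lattice gauge theory
(S. Chatterjee, *The leading term of the Yang–Mills free energy*, J. Funct. Anal. 271 (2016),
arXiv:1602.01222, §§6, 7, 11, 16), first step of the inline proof of the named fact
`Literature.MathematicalPhysics.QuantumFieldTheory.chatterjee_freeEnergyDensity`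
(`LatticeGaugeAsymptotics.lean`). Everything here is proved; no definition of `Prop` type
(named fact) is introduced.

Chatterjee replaces integrals over the Lie group `U(N)` near the identity by integrals over its
Lie algebra through the exponential chart `H ↦ e^{iH}` (§11, Thm. 11.1), with the sharp constant
`C_N = ∏_{j<N} j!/(2π)^{N(N+1)/2}` coming from the small-ball asymptotics of Haar measure
(§6, Thm. 6.1, Weyl's integration formula). For the *existence* of the constants in
`chatterjee_freeEnergyDensity` the value of `C_N` is immaterial, and we proceed softly:

* `UnitaryCayley.cay`, `chart`: the **Cayley chart** `a ↦ (2 + X)(2 - X)⁻¹`, `X = skewOf a`,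
  from `ℝ^{N²}` (`𝔼 N = EuclideanSpace ℝ (Fin N × Fin N)`, an isometric parametrisation
  `skewOf` of the skew-Hermitian matrices for the Hilbert–Schmidt norm) onto a neighbourhood of
  `1` in `U(N)` (`𝔾 N = Matrix.unitaryGroup (Fin N) ℂ`). It is rational, `1`-Lipschitz
  (`norm_chart_sub_chart_le`, from the identity `‖(2 - X) C‖² = 4‖C‖² + ‖XC‖²`), with inverse
  `ichart U = unskew (2(U-1)(U+1)⁻¹)` on `‖U - 1‖ < 2` and inverse Lipschitz constant
  `(1 + ‖a‖/2)(1 + ‖b‖/2)`; and `cay X = 1 + X + X²/2 + X³(2-X)⁻¹/2` agrees with `exp` to second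
  order (`two_smul_cay`, `norm_cay_sub_taylor_le`; cf. Lemma 16.1).
* `chartMeasure` (`ν = chart^* σ`), the **ball squeeze**
  `σ(B(1, δ/κ(r))) ≤ ν(b(a, δ)) ≤ σ(B(1, δ))` for `‖a‖ ≤ r ≤ 1/2`, `δ ≤ r`,
  `κ(r) = (1+2r)(1+r/2)` (cf. Cor. 11.3 and Lemma 11.5: Hilbert–Schmidt balls are left
  translates of `B(1, δ)`).
* `exists_tendsto_ballRatio`, `haarChartConst`: the ratio `σ(B(1,δ))/vol(b(0,δ))` has a limit
  `c_N ∈ (0, ∞)` as `δ → 0` — a soft substitute for Thm. 6.1: Lebesgue's differentiation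
  theorem (Besicovitch, `Besicovitch.ae_tendsto_rnDeriv`) at one density point of `ν` inside
  `b(0, r)` and the squeeze give `limsup ≤ κ(r)^{N²} liminf` for every `r`; positivity by the
  covering lemma `VitaliFamily.measure_le_of_frequently_le`.
* `chartMeasure_le`, `le_chartMeasure_of_subset`: **comparison of measures**
  `c_N κ(r)^{-N²} vol ≤ ν ≤ c_N vol` on `b(0, r)`, `r ≤ 1/2` (the analogue of Thm. 11.1 with the
  soft constant, again by the covering lemma), the integral forms `lintegral_image_chart_le`,
  `le_lintegral_image_chart` and their finite product versions
  `lintegral_pi_image_chart_le`, `le_lintegral_pi_image_chart` (Thm. 11.1, second assertion),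
  with `pi_mono`, `pi_const_smul` for finite product measures.
* `exists_haar_gball_ge`: `σ(B(1, δ)) ≥ C δ^{N²}` for `0 < δ ≤ 1` (Cor. 6.3, lower half),
  and `gball_subset_image_chart`, `image_chart_subset_gball` (`B(1, r/κ(r)) ⊆ chart(b(0,r)) ⊆ B(1,r)`).
* Hilbert–Schmidt geometry of `U(N)` (§7): `re_trace_one_sub` (Lemma 7.2,
  `Re tr(1 - U) = ½‖1 - U‖²`), `norm_one_sub_inv` (Lemma 7.5), `norm_one_sub_prod_le`,
  `norm_one_sub_plaquetteWord_le` (Lemma 7.4).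

Not here: the exact value of `c_N` (Weyl integration), the exponential chart, anything about
lattices. Matrices carry the Frobenius norm (`open scoped Matrix.Norms.Frobenius`).

## References

* S. Chatterjee, *The leading term of the Yang–Mills free energy*, J. Funct. Anal. 271 (2016)
  2944–3005, arXiv:1602.01222, §6 (Thm. 6.1, Cor. 6.3), §7 (Lemmas 7.2–7.5), §11 (Thm. 11.1,
  Lemma 11.2, Cor. 11.3, Lemma 11.5), §16 (Lemma 16.1). [arXiv160201222]
-/

noncomputable section

open scoped Matrix.Norms.Frobenius
open Matrix

namespace Literature.MathematicalPhysics.QuantumFieldTheory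

namespace UnitaryCayley

variable {N : ℕ}

local notation "𝕄" => Matrix (Fin N) (Fin N) ℂ

/-- `(2 - X)ᴴ = 2 + X` for a skew-Hermitian matrix `X`. [folklore] -/
theorem conjTranspose_two_sub {X : 𝕄} (hX : Xᴴ = -X) : (2 - X)ᴴ = 2 + X := by
  rw [conjTranspose_sub, conjTranspose_ofNat, hX, sub_neg_eq_add]

/-- `(2 + X)ᴴ = 2 - X` for a skew-Hermitian matrix `X`. [folklore] -/
theorem conjTranspose_two_add {X : 𝕄} (hX : Xᴴ = -X) : (2 + X)ᴴ = 2 - X := by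
  rw [conjTranspose_add, conjTranspose_ofNat, hX, ← sub_eq_add_neg]

/-- The key identity behind the contraction property of the Cayley transform: for `X`
skew-Hermitian and any `C`, `‖(2 - X) C‖² = 4 ‖C‖² + ‖X C‖²` (Frobenius norms). [folklore] -/
theorem norm_two_sub_mul_sq {X : 𝕄} (hX : Xᴴ = -X) (C : 𝕄) :
    ‖(2 - X) * C‖ ^ 2 = 4 * ‖C‖ ^ 2 + ‖X * C‖ ^ 2 := by
  have h : ((2 - X) * C)ᴴ * ((2 - X) * C) = 4 • (Cᴴ * C) + (X * C)ᴴ * (X * C) := by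
    rw [conjTranspose_mul, conjTranspose_mul, conjTranspose_two_sub hX, hX]
    noncomm_ring
  rw [Matrix.frobenius_norm_sq_eq_re_trace, h, Matrix.trace_add, map_add,
    ← Matrix.frobenius_norm_sq_eq_re_trace (X * C), Matrix.trace_smul, map_nsmul,
    ← Matrix.frobenius_norm_sq_eq_re_trace C, nsmul_eq_mul]
  push_cast
  ring

/-- Dually `‖C (2 - X)‖² = 4 ‖C‖² + ‖C X‖²`. [folklore] -/
theorem norm_mul_two_sub_sq {X : 𝕄} (hX : Xᴴ = -X) (C : 𝕄) :
    ‖C * (2 - X)‖ ^ 2 = 4 * ‖C‖ ^ 2 + ‖C * X‖ ^ 2 := by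
  have h1 : ‖C * (2 - X)‖ = ‖(2 + X) * Cᴴ‖ := by
    rw [← frobenius_norm_conjTranspose (C * (2 - X)), conjTranspose_mul, conjTranspose_two_sub hX]
  have h2 : ‖C * X‖ = ‖X * Cᴴ‖ := by
    rw [← frobenius_norm_conjTranspose (C * X), conjTranspose_mul, hX, neg_mul, norm_neg]
  have hX' : (-X)ᴴ = -(-X) := by rw [conjTranspose_neg, hX]
  have h3 := norm_two_sub_mul_sq hX' Cᴴ
  rw [sub_neg_eq_add, neg_mul, norm_neg, frobenius_norm_conjTranspose] at h3
  rw [h1, h2, h3]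

/-- `2 ‖C‖ ≤ ‖(2 - X) C‖` for skew-Hermitian `X`. [folklore] -/
theorem two_mul_norm_le_norm_two_sub_mul {X : 𝕄} (hX : Xᴴ = -X) (C : 𝕄) :
    2 * ‖C‖ ≤ ‖(2 - X) * C‖ := by
  have h := norm_two_sub_mul_sq hX C
  refine le_of_sq_le_sq ?_ (norm_nonneg _)
  rw [h, mul_pow]
  nlinarith [sq_nonneg ‖X * C‖]

/-- `2 ‖C‖ ≤ ‖C (2 - X)‖` for skew-Hermitian `X`. [folklore] -/
theorem two_mul_norm_le_norm_mul_two_sub {X : 𝕄} (hX : Xᴴ = -X) (C : 𝕄) :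
    2 * ‖C‖ ≤ ‖C * (2 - X)‖ := by
  have h := norm_mul_two_sub_sq hX C
  refine le_of_sq_le_sq ?_ (norm_nonneg _)
  rw [h, mul_pow]
  nlinarith [sq_nonneg ‖C * X‖]

/-- `2 - X` is invertible for skew-Hermitian `X`. [folklore] -/
theorem isUnit_two_sub {X : 𝕄} (hX : Xᴴ = -X) : IsUnit (2 - X) := by
  have hinj : Function.Injective (LinearMap.mulLeft ℂ (2 - X)) := by
    intro C D hCD
    have h0 : (2 - X) * (C - D) = 0 := by
      simp only [LinearMap.mulLeft_apply] at hCD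
      rw [mul_sub, hCD, sub_self]
    have h1 := two_mul_norm_le_norm_two_sub_mul hX (C - D)
    rw [h0, norm_zero] at h1
    have h2 : ‖C - D‖ = 0 := le_antisymm (by linarith [norm_nonneg (C - D)]) (norm_nonneg _)
    exact sub_eq_zero.1 (norm_eq_zero.1 h2)
  have hsurj : Function.Surjective (LinearMap.mulLeft ℂ (2 - X)) :=
    LinearMap.injective_iff_surjective.1 hinj
  obtain ⟨C, hC⟩ := hsurj 1
  exact IsUnit.of_mul_eq_one C hC

/-- `2 + X` is invertible for skew-Hermitian `X`. [folklore] -/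
theorem isUnit_two_add {X : 𝕄} (hX : Xᴴ = -X) : IsUnit (2 + X) := by
  have hX' : (-X)ᴴ = -(-X) := by rw [conjTranspose_neg, hX]
  simpa using isUnit_two_sub hX'

/-- The Cayley transform `cay X = (2 + X)(2 - X)⁻¹` of a (skew-Hermitian) matrix; with this
normalisation `cay X = 1 + X + X²/2 + O(X³)` agrees with `exp X` to second order. [folklore] -/
def cay (X : 𝕄) : 𝕄 := (2 + X) * (2 - X)⁻¹

/-- `(2 + X)(2 - X) = (2 - X)(2 + X)`. [folklore] -/
theorem two_add_mul_two_sub_comm (X : 𝕄) : (2 + X) * (2 - X) = (2 - X) * (2 + X) := by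
  noncomm_ring

/-- `cay X = (2 - X)⁻¹ (2 + X)` as well (the factors commute). [folklore] -/
theorem cay_eq_inv_mul {X : 𝕄} (hX : Xᴴ = -X) : cay X = (2 - X)⁻¹ * (2 + X) := by
  have hu := (isUnit_iff_isUnit_det _).1 (isUnit_two_sub hX)
  rw [cay]
  calc (2 + X) * (2 - X)⁻¹ = (2 - X)⁻¹ * ((2 - X) * (2 + X)) * (2 - X)⁻¹ := by
        rw [← Matrix.mul_assoc, Matrix.nonsing_inv_mul _ hu, Matrix.one_mul]
    _ = (2 - X)⁻¹ * ((2 + X) * (2 - X)) * (2 - X)⁻¹ := by rw [two_add_mul_two_sub_comm]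
    _ = (2 - X)⁻¹ * (2 + X) := by
        rw [Matrix.mul_assoc, Matrix.mul_assoc, Matrix.mul_nonsing_inv _ hu, Matrix.mul_one]

/-- The Cayley transform of a skew-Hermitian matrix is unitary. [folklore] -/
theorem cay_mem_unitaryGroup {X : 𝕄} (hX : Xᴴ = -X) : cay X ∈ Matrix.unitaryGroup (Fin N) ℂ := by
  have hu := (isUnit_iff_isUnit_det _).1 (isUnit_two_sub hX)
  have hu' := (isUnit_iff_isUnit_det _).1 (isUnit_two_add hX)
  rw [Matrix.mem_unitaryGroup_iff, star_eq_conjTranspose]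
  -- `cay X (cay X)ᴴ = (2+X)(2-X)⁻¹ ((2-X)⁻¹)ᴴ (2+X)ᴴ = (2+X)(2-X)⁻¹ (2+X)⁻¹ (2-X)`
  rw [cay, conjTranspose_mul, conjTranspose_nonsing_inv, conjTranspose_two_sub hX,
    conjTranspose_two_add hX]
  calc (2 + X) * (2 - X)⁻¹ * ((2 + X)⁻¹ * (2 - X))
      = (2 + X) * ((2 - X)⁻¹ * (2 + X)⁻¹) * (2 - X) := by simp only [Matrix.mul_assoc]
    _ = (2 + X) * ((2 + X) * (2 - X))⁻¹ * (2 - X) := by rw [Matrix.mul_inv_rev]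
    _ = (2 + X) * ((2 - X) * (2 + X))⁻¹ * (2 - X) := by rw [two_add_mul_two_sub_comm]
    _ = (2 + X) * ((2 + X)⁻¹ * (2 - X)⁻¹) * (2 - X) := by rw [Matrix.mul_inv_rev]
    _ = ((2 + X) * (2 + X)⁻¹) * ((2 - X)⁻¹ * (2 - X)) := by simp only [Matrix.mul_assoc]
    _ = 1 := by rw [Matrix.mul_nonsing_inv _ hu', Matrix.nonsing_inv_mul _ hu, Matrix.mul_one]

/-- `cay 0 = 1`. [folklore] -/
@[simp] theorem cay_zero : cay (0 : 𝕄) = 1 := by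
  have h0 : (0 : 𝕄)ᴴ = -0 := by rw [conjTranspose_zero, neg_zero]
  have hu := (isUnit_iff_isUnit_det _).1 (isUnit_two_sub h0)
  rw [sub_zero] at hu
  rw [cay, add_zero, sub_zero, Matrix.mul_nonsing_inv _ hu]

/-- `(2 + X)(2 - Y) - (2 - X)(2 + Y) = 4 (X - Y)`. [folklore] -/
theorem two_add_mul_two_sub_sub (X Y : 𝕄) :
    (2 + X) * (2 - Y) - (2 - X) * (2 + Y) = (4 : ℂ) • (X - Y) := by
  have h : (2 + X) * (2 - Y) - (2 - X) * (2 + Y) = 4 • (X - Y) := by noncomm_ring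
  rw [h, ← Nat.cast_smul_eq_nsmul ℂ]
  norm_num

/-- The difference formula `cay X - cay Y = 4 (2 - X)⁻¹ (X - Y) (2 - Y)⁻¹`. [folklore] -/
theorem cay_sub_cay {X Y : 𝕄} (hX : Xᴴ = -X) (hY : Yᴴ = -Y) :
    cay X - cay Y = (4 : ℂ) • ((2 - X)⁻¹ * (X - Y) * (2 - Y)⁻¹) := by
  have huX := (isUnit_iff_isUnit_det _).1 (isUnit_two_sub hX)
  have huY := (isUnit_iff_isUnit_det _).1 (isUnit_two_sub hY)
  have e1 : (2 - X)⁻¹ * (2 + X) = (2 - X)⁻¹ * ((2 + X) * (2 - Y)) * (2 - Y)⁻¹ := by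
    rw [Matrix.mul_assoc, Matrix.mul_assoc, Matrix.mul_nonsing_inv _ huY, Matrix.mul_one]
  have e2 : (2 + Y) * (2 - Y)⁻¹ = (2 - X)⁻¹ * ((2 - X) * (2 + Y)) * (2 - Y)⁻¹ := by
    rw [← Matrix.mul_assoc, Matrix.nonsing_inv_mul _ huX, Matrix.one_mul]
  rw [cay_eq_inv_mul hX, cay, e1, e2, ← Matrix.sub_mul, ← Matrix.mul_sub,
    two_add_mul_two_sub_sub, Matrix.mul_smul, Matrix.smul_mul]

/-- The Cayley transform is `1`-Lipschitz for the Frobenius norm on skew-Hermitian matrices. [folklore] -/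
theorem norm_cay_sub_cay_le {X Y : 𝕄} (hX : Xᴴ = -X) (hY : Yᴴ = -Y) :
    ‖cay X - cay Y‖ ≤ ‖X - Y‖ := by
  have huX := (isUnit_iff_isUnit_det _).1 (isUnit_two_sub hX)
  have huY := (isUnit_iff_isUnit_det _).1 (isUnit_two_sub hY)
  rw [cay_sub_cay hX hY, norm_smul]
  -- `‖(2-X)⁻¹ B‖ ≤ ‖B‖/2` and `‖B (2-Y)⁻¹‖ ≤ ‖B‖/2`
  have h1 : ∀ B : 𝕄, ‖(2 - X)⁻¹ * B‖ ≤ ‖B‖ / 2 := fun B => by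
    have h := two_mul_norm_le_norm_two_sub_mul hX ((2 - X)⁻¹ * B)
    rw [← Matrix.mul_assoc, Matrix.mul_nonsing_inv _ huX, Matrix.one_mul] at h
    linarith
  have h2 : ∀ B : 𝕄, ‖B * (2 - Y)⁻¹‖ ≤ ‖B‖ / 2 := fun B => by
    have h := two_mul_norm_le_norm_mul_two_sub hY (B * (2 - Y)⁻¹)
    rw [Matrix.mul_assoc, Matrix.nonsing_inv_mul _ huY, Matrix.mul_one] at h
    linarith
  have h3 : ‖(2 - X)⁻¹ * (X - Y) * (2 - Y)⁻¹‖ ≤ ‖X - Y‖ / 4 := by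
    calc ‖(2 - X)⁻¹ * (X - Y) * (2 - Y)⁻¹‖ ≤ ‖(2 - X)⁻¹ * (X - Y)‖ / 2 := h2 _
      _ ≤ (‖X - Y‖ / 2) / 2 := by gcongr; exact h1 _
      _ = ‖X - Y‖ / 4 := by ring
  have h4 : ‖(4 : ℂ)‖ = 4 := by simp
  rw [h4]
  linarith

/-- `‖(2 - X) B‖ ≤ (2 + ‖X‖) ‖B‖`. [folklore] -/
theorem norm_two_sub_mul_le (X B : 𝕄) : ‖(2 - X) * B‖ ≤ (2 + ‖X‖) * ‖B‖ := by
  rw [Matrix.sub_mul, two_mul]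
  calc ‖B + B - X * B‖ ≤ ‖B + B‖ + ‖X * B‖ := norm_sub_le _ _
    _ ≤ (‖B‖ + ‖B‖) + ‖X‖ * ‖B‖ := add_le_add (norm_add_le _ _) (Matrix.frobenius_norm_mul _ _)
    _ = (2 + ‖X‖) * ‖B‖ := by ring

/-- `‖B (2 - Y)‖ ≤ (2 + ‖Y‖) ‖B‖`. [folklore] -/
theorem norm_mul_two_sub_le (B Y : 𝕄) : ‖B * (2 - Y)‖ ≤ (2 + ‖Y‖) * ‖B‖ := by
  rw [Matrix.mul_sub, mul_two]
  calc ‖B + B - B * Y‖ ≤ ‖B + B‖ + ‖B * Y‖ := norm_sub_le _ _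
    _ ≤ (‖B‖ + ‖B‖) + ‖B‖ * ‖Y‖ := add_le_add (norm_add_le _ _) (Matrix.frobenius_norm_mul _ _)
    _ = (2 + ‖Y‖) * ‖B‖ := by ring

/-- Inverse Lipschitz bound: `‖X - Y‖ ≤ (1 + ‖X‖/2)(1 + ‖Y‖/2) ‖cay X - cay Y‖`. [folklore] -/
theorem norm_sub_le_norm_cay_sub_cay {X Y : 𝕄} (hX : Xᴴ = -X) (hY : Yᴴ = -Y) :
    ‖X - Y‖ ≤ (1 + ‖X‖ / 2) * (1 + ‖Y‖ / 2) * ‖cay X - cay Y‖ := by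
  have huX := (isUnit_iff_isUnit_det _).1 (isUnit_two_sub hX)
  have huY := (isUnit_iff_isUnit_det _).1 (isUnit_two_sub hY)
  have e : X - Y = (4 : ℂ)⁻¹ • ((2 - X) * (cay X - cay Y) * (2 - Y)) := by
    rw [cay_sub_cay hX hY, Matrix.mul_smul, Matrix.smul_mul, smul_smul,
      inv_mul_cancel₀ (by norm_num : (4 : ℂ) ≠ 0), one_smul]
    rw [← Matrix.mul_assoc, ← Matrix.mul_assoc, Matrix.mul_nonsing_inv _ huX, Matrix.one_mul,
      Matrix.mul_assoc, Matrix.nonsing_inv_mul _ huY, Matrix.mul_one]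
  have h1 : ‖(2 - X) * (cay X - cay Y) * (2 - Y)‖ ≤
      (2 + ‖Y‖) * ((2 + ‖X‖) * ‖cay X - cay Y‖) :=
    (norm_mul_two_sub_le _ _).trans (by gcongr; exact norm_two_sub_mul_le _ _)
  have h4 : ‖(4 : ℂ)⁻¹‖ = 4⁻¹ := by simp
  rw [e, norm_smul, h4]
  have := norm_nonneg (cay X - cay Y)
  nlinarith [h1, norm_nonneg X, norm_nonneg Y]

/-! ### The inverse Cayley transform near the identity -/

/-- A matrix `A` with `c ‖C‖ ≤ ‖A C‖` for all `C` and some `c > 0` is invertible. [folklore] -/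
theorem isUnit_of_forall_le_norm_mul {A : 𝕄} {c : ℝ} (hc : 0 < c)
    (h : ∀ C : 𝕄, c * ‖C‖ ≤ ‖A * C‖) : IsUnit A := by
  have hinj : Function.Injective (LinearMap.mulLeft ℂ A) := by
    intro C D hCD
    have h0 : A * (C - D) = 0 := by
      simp only [LinearMap.mulLeft_apply] at hCD
      rw [mul_sub, hCD, sub_self]
    have h1 := h (C - D)
    rw [h0, norm_zero] at h1
    have h2 : ‖C - D‖ = 0 :=
      le_antisymm (nonpos_of_mul_nonpos_right (by linarith) hc |> fun h => by
        nlinarith [norm_nonneg (C - D)]) (norm_nonneg _)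
    exact sub_eq_zero.1 (norm_eq_zero.1 h2)
  obtain ⟨C, hC⟩ := (LinearMap.injective_iff_surjective.1 hinj) 1
  exact IsUnit.of_mul_eq_one C hC

/-- `(2 - ‖U - 1‖) ‖C‖ ≤ ‖(U + 1) C‖`. [folklore] -/
theorem norm_add_one_mul_ge (U C : 𝕄) : (2 - ‖U - 1‖) * ‖C‖ ≤ ‖(U + 1) * C‖ := by
  have e : (U + 1) * C = (C + C) + (U - 1) * C := by noncomm_ring
  rw [e]
  have h1 : ‖C + C‖ = 2 * ‖C‖ := by rw [← two_smul ℝ C, norm_smul, Real.norm_two]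
  have h2 : ‖(U - 1) * C‖ ≤ ‖U - 1‖ * ‖C‖ := Matrix.frobenius_norm_mul _ _
  have h3 := norm_add_le (C + C + (U - 1) * C) (-((U - 1) * C))
  rw [add_neg_cancel_right, norm_neg, h1] at h3
  nlinarith

/-- `(2 - ‖U - 1‖) ‖C‖ ≤ ‖C (U + 1)‖`. [folklore] -/
theorem norm_mul_add_one_ge (C U : 𝕄) : (2 - ‖U - 1‖) * ‖C‖ ≤ ‖C * (U + 1)‖ := by
  have e : C * (U + 1) = (C + C) + C * (U - 1) := by noncomm_ring
  rw [e]
  have h1 : ‖C + C‖ = 2 * ‖C‖ := by rw [← two_smul ℝ C, norm_smul, Real.norm_two]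
  have h2 : ‖C * (U - 1)‖ ≤ ‖C‖ * ‖U - 1‖ := Matrix.frobenius_norm_mul _ _
  have h3 := norm_add_le (C + C + C * (U - 1)) (-(C * (U - 1)))
  rw [add_neg_cancel_right, norm_neg, h1] at h3
  nlinarith

/-- `U + 1` is invertible when `‖U - 1‖ < 2`. [folklore] -/
theorem isUnit_add_one {U : 𝕄} (hU : ‖U - 1‖ < 2) : IsUnit (U + 1) :=
  isUnit_of_forall_le_norm_mul (by linarith) (norm_add_one_mul_ge U)

/-- The inverse Cayley transform `icay U = 2 (U - 1)(U + 1)⁻¹` (meaningful for `‖U - 1‖ < 2`). [folklore] -/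
def icay (U : 𝕄) : 𝕄 := (2 : ℂ) • ((U - 1) * (U + 1)⁻¹)

/-- `icay 1 = 0`. [folklore] -/
@[simp] theorem icay_one : icay (1 : 𝕄) = 0 := by simp [icay]

/-- `(U - 1)(U + 1) = (U + 1)(U - 1)`. [folklore] -/
theorem sub_one_mul_add_one_comm (U : 𝕄) : (U - 1) * (U + 1) = (U + 1) * (U - 1) := by
  noncomm_ring

/-- `(U - 1)(U + 1)⁻¹ = (U + 1)⁻¹ (U - 1)` when `U + 1` is invertible. [folklore] -/
theorem sub_one_mul_inv_comm {U : 𝕄} (hu : IsUnit (U + 1).det) :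
    (U - 1) * (U + 1)⁻¹ = (U + 1)⁻¹ * (U - 1) := by
  calc (U - 1) * (U + 1)⁻¹ = (U + 1)⁻¹ * ((U + 1) * (U - 1)) * (U + 1)⁻¹ := by
        rw [← Matrix.mul_assoc, Matrix.nonsing_inv_mul _ hu, Matrix.one_mul]
    _ = (U + 1)⁻¹ * ((U - 1) * (U + 1)) * (U + 1)⁻¹ := by rw [sub_one_mul_add_one_comm]
    _ = (U + 1)⁻¹ * (U - 1) := by
        rw [Matrix.mul_assoc, Matrix.mul_assoc, Matrix.mul_nonsing_inv _ hu, Matrix.mul_one]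

/-- Norm bound for the inverse Cayley transform: `(2 - ‖U - 1‖) ‖icay U‖ ≤ 2 ‖U - 1‖`. [folklore] -/
theorem norm_icay_le {U : 𝕄} (hU : ‖U - 1‖ < 2) : (2 - ‖U - 1‖) * ‖icay U‖ ≤ 2 * ‖U - 1‖ := by
  have hu := (isUnit_iff_isUnit_det _).1 (isUnit_add_one hU)
  have h := norm_mul_add_one_ge ((U - 1) * (U + 1)⁻¹) U
  rw [Matrix.mul_assoc, Matrix.nonsing_inv_mul _ hu, Matrix.mul_one] at h
  have e : ‖icay U‖ = 2 * ‖(U - 1) * (U + 1)⁻¹‖ := by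
    rw [icay, norm_smul]; norm_num
  rw [e]
  nlinarith

/-- `icay U` is skew-Hermitian for unitary `U` with `‖U - 1‖ < 2`. [folklore] -/
theorem conjTranspose_icay {U : 𝕄} (hUu : U ∈ Matrix.unitaryGroup (Fin N) ℂ) (hU : ‖U - 1‖ < 2) :
    (icay U)ᴴ = -icay U := by
  have hu := (isUnit_iff_isUnit_det _).1 (isUnit_add_one hU)
  have h1 : Uᴴ * U = 1 := by
    rw [← star_eq_conjTranspose]; exact Matrix.mem_unitaryGroup_iff'.1 hUu
  have h2 : U * Uᴴ = 1 := by
    rw [← star_eq_conjTranspose]; exact Matrix.mem_unitaryGroup_iff.1 hUu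
  -- `(U+1)ᴴ = Uᴴ (1 + U)` hence `((U+1)⁻¹)ᴴ = ((U+1)ᴴ)⁻¹ = (1+U)⁻¹ U`
  have hconj : (U + 1)ᴴ = Uᴴ * (U + 1) := by
    rw [conjTranspose_add, conjTranspose_one, Matrix.mul_add, h1, Matrix.mul_one, add_comm]
  have hUdet : IsUnit (Uᴴ).det := Matrix.isUnit_det_of_left_inverse h2
  have hinv : ((U + 1)ᴴ)⁻¹ = (U + 1)⁻¹ * U := by
    rw [hconj, Matrix.mul_inv_rev]
    congr 1
    exact Matrix.inv_eq_left_inv h2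
  rw [icay, conjTranspose_smul, conjTranspose_mul, conjTranspose_nonsing_inv, hinv,
    conjTranspose_sub, conjTranspose_one]
  have hs : star (2 : ℂ) = 2 := by rw [Complex.star_def, map_ofNat]
  rw [hs, ← smul_neg]
  congr 1
  -- `(U+1)⁻¹ U (Uᴴ - 1) = (U+1)⁻¹ (1 - U) = -((U - 1)(U+1)⁻¹)`
  rw [Matrix.mul_assoc, Matrix.mul_sub, h2, Matrix.mul_one, sub_one_mul_inv_comm hu,
    ← Matrix.mul_neg, neg_sub]

/-- `cay` is determined by `cay X (2 - X) = 2 + X`. [folklore] -/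
theorem cay_eq_of_mul_eq {X M : 𝕄} (hX : Xᴴ = -X) (h : M * (2 - X) = 2 + X) : cay X = M := by
  have hu := (isUnit_iff_isUnit_det _).1 (isUnit_two_sub hX)
  rw [cay, ← h, Matrix.mul_assoc, Matrix.mul_nonsing_inv _ hu, Matrix.mul_one]

/-- `cay (icay U) = U` for unitary `U` with `‖U - 1‖ < 2`. [folklore] -/
theorem cay_icay {U : 𝕄} (hUu : U ∈ Matrix.unitaryGroup (Fin N) ℂ) (hU : ‖U - 1‖ < 2) :
    cay (icay U) = U := by
  have hu := (isUnit_iff_isUnit_det _).1 (isUnit_add_one hU)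
  refine cay_eq_of_mul_eq (conjTranspose_icay hUu hU) ?_
  -- cancel `U + 1` on the right
  rw [← Matrix.mul_nonsing_inv_cancel_right (U + 1) (U * (2 - icay U)) hu,
    ← Matrix.mul_nonsing_inv_cancel_right (U + 1) (2 + icay U) hu]
  congr 1
  have hX : icay U * (U + 1) = (2 : ℂ) • (U - 1) := by
    rw [icay, Matrix.smul_mul, Matrix.nonsing_inv_mul_cancel_right (U + 1) (U - 1) hu]
  rw [Matrix.mul_sub, Matrix.sub_mul, Matrix.add_mul, Matrix.mul_assoc U (icay U), hX]
  simp only [two_smul, mul_two, two_mul]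
  noncomm_ring

/-- `icay (cay X) = X` for skew-Hermitian `X`. [folklore] -/
theorem icay_cay {X : 𝕄} (hX : Xᴴ = -X) : icay (cay X) = X := by
  have hu := (isUnit_iff_isUnit_det _).1 (isUnit_two_sub hX)
  have h4 : (2 : 𝕄) + X + (2 - X) = (4 : ℂ) • (1 : 𝕄) := by
    rw [show (2 : 𝕄) + X + (2 - X) = 2 + 2 by abel,
      show (4 : ℂ) = ((4 : ℕ) : ℂ) by norm_num, Nat.cast_smul_eq_nsmul, Nat.smul_one_eq_cast]
    norm_num
  have h1 : cay X + 1 = (4 : ℂ) • (2 - X)⁻¹ := by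
    conv_lhs => rw [cay, ← Matrix.mul_nonsing_inv (2 - X) hu, ← Matrix.add_mul, h4]
    rw [Matrix.smul_mul, Matrix.one_mul]
  have h2 : cay X - 1 = (2 : ℂ) • (X * (2 - X)⁻¹) := by
    conv_lhs => rw [cay, ← Matrix.mul_nonsing_inv (2 - X) hu, ← Matrix.sub_mul,
      show (2 : 𝕄) + X - (2 - X) = (2 : ℂ) • X by rw [two_smul]; abel]
    rw [Matrix.smul_mul]
  have h3 : (cay X + 1)⁻¹ = (4 : ℂ)⁻¹ • (2 - X) := by
    rw [h1]
    refine Matrix.inv_eq_left_inv ?_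
    rw [Matrix.smul_mul, Matrix.mul_smul, smul_smul, Matrix.mul_nonsing_inv _ hu,
      inv_mul_cancel₀ (by norm_num : (4 : ℂ) ≠ 0), one_smul]
  rw [icay, h3, h2, Matrix.smul_mul, Matrix.mul_smul, Matrix.nonsing_inv_mul_cancel_right (2 - X) X hu,
    smul_smul, smul_smul]
  norm_num

/-! ### Euclidean coordinates on skew-Hermitian matrices -/

variable (N) in
/-- The parameter space `ℝ^{N²}` of the chart, with its Euclidean norm and Lebesgue measure. [folklore] -/
abbrev 𝔼 : Type := EuclideanSpace ℝ (Fin N × Fin N)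

/-- The squared Frobenius norm is the sum of the squared moduli of the entries. [folklore] -/
theorem frobenius_norm_sq (A : 𝕄) : ‖A‖ ^ 2 = ∑ j, ∑ k, ‖A j k‖ ^ 2 := by
  rw [Matrix.frobenius_norm_def, ← Real.sqrt_eq_rpow,
    Real.sq_sqrt (Finset.sum_nonneg fun i _ => Finset.sum_nonneg fun j _ => by positivity)]
  simp

/-- The real-linear parametrisation of skew-Hermitian matrices by `ℝ^{N×N}`:
entry `(j,k)` is `(a_{jk} - a_{kj})/2 + i (a_{jk} + a_{kj})/2`. It is an isometry for the
Euclidean and Frobenius (Hilbert–Schmidt) norms (Chatterjee arXiv:1602.01222 §11 uses the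
analogous isometry `H(N) ≅ ℝ^{N²}`). [cite: arXiv160201222, §11] -/
def skewOf : 𝔼 N →ₗᵢ[ℝ] 𝕄 where
  toFun a := Matrix.of fun j k : Fin N =>
    (⟨(a (j, k) - a (k, j)) / 2, (a (j, k) + a (k, j)) / 2⟩ : ℂ)
  map_add' a b := by
    ext j k
    simp only [PiLp.add_apply, Matrix.of_apply, Matrix.add_apply, Complex.ext_iff, Complex.add_re,
      Complex.add_im]
    constructor <;> ring
  map_smul' c a := by
    ext j k
    simp only [PiLp.smul_apply, smul_eq_mul, Matrix.of_apply, Matrix.smul_apply, RingHom.id_apply,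
      Complex.real_smul, Complex.ext_iff, Complex.mul_re, Complex.mul_im, Complex.ofReal_re,
      Complex.ofReal_im]
    constructor <;> ring
  norm_map' a := by
    have h1 : ‖(Matrix.of fun j k : Fin N =>
        (⟨(a (j, k) - a (k, j)) / 2, (a (j, k) + a (k, j)) / 2⟩ : ℂ))‖ ^ 2 = ‖a‖ ^ 2 := by
      rw [frobenius_norm_sq, EuclideanSpace.norm_eq, Real.sq_sqrt (Finset.sum_nonneg fun _ _ => by
        positivity), Fintype.sum_prod_type]
      simp only [Matrix.of_apply, Complex.sq_norm, Complex.normSq_mk, Real.norm_eq_abs, sq_abs]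
      have e : ∀ j : Fin N, ∑ k, ((a (j, k) - a (k, j)) / 2 * ((a (j, k) - a (k, j)) / 2) +
          (a (j, k) + a (k, j)) / 2 * ((a (j, k) + a (k, j)) / 2)) =
          ∑ k, (a (j, k) ^ 2 / 2 + a (k, j) ^ 2 / 2) := fun j =>
        Finset.sum_congr rfl fun k _ => by ring
      simp only [e, Finset.sum_add_distrib]
      rw [Finset.sum_comm (f := fun j k => a (k, j) ^ 2 / 2), ← Finset.sum_add_distrib]
      refine Finset.sum_congr rfl fun j _ => ?_
      rw [← Finset.sum_add_distrib]
      exact Finset.sum_congr rfl fun k _ => by ring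
    simpa using (sq_eq_sq₀ (norm_nonneg _) (norm_nonneg _)).1 h1

/-- The entries of `skewOf a`. [folklore] -/
theorem skewOf_apply (a : 𝔼 N) (j k : Fin N) :
    skewOf a j k = (⟨(a (j, k) - a (k, j)) / 2, (a (j, k) + a (k, j)) / 2⟩ : ℂ) := rfl

/-- `skewOf a` is skew-Hermitian. [folklore] -/
theorem conjTranspose_skewOf (a : 𝔼 N) : (skewOf a)ᴴ = -skewOf a := by
  ext j k
  simp only [conjTranspose_apply, skewOf_apply, RCLike.star_def, Matrix.neg_apply, Complex.ext_iff,
    Complex.conj_re, Complex.conj_im, Complex.neg_re, Complex.neg_im]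
  constructor <;> ring

/-- Left inverse of `skewOf`: coordinate `(j,k)` is `re X_{jk} + im X_{jk}`. [folklore] -/
def unskew (X : 𝕄) : 𝔼 N := WithLp.toLp 2 fun p : Fin N × Fin N => (X p.1 p.2).re + (X p.1 p.2).im

/-- The coordinates of `unskew X`. [folklore] -/
@[simp] theorem unskew_apply (X : 𝕄) (p : Fin N × Fin N) :
    unskew X p = (X p.1 p.2).re + (X p.1 p.2).im := rfl

/-- `unskew` is a left inverse of `skewOf`. [folklore] -/
@[simp] theorem unskew_skewOf (a : 𝔼 N) : unskew (skewOf a) = a := by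
  ext ⟨j, k⟩
  simp only [unskew_apply, skewOf_apply]
  ring

/-- `skewOf (unskew X) = X` for skew-Hermitian `X`. [folklore] -/
theorem skewOf_unskew {X : 𝕄} (hX : Xᴴ = -X) : skewOf (unskew X) = X := by
  ext j k
  have h := congr_fun (congr_fun hX j) k
  simp only [conjTranspose_apply, Matrix.neg_apply, RCLike.star_def, Complex.ext_iff,
    Complex.conj_re, Complex.conj_im, Complex.neg_re, Complex.neg_im] at h
  simp only [skewOf_apply, unskew_apply, Complex.ext_iff]
  constructor <;> linarith [h.1, h.2]

/-- `unskew 0 = 0`. [folklore] -/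
theorem unskew_zero : unskew (0 : 𝕄) = 0 := by
  rw [← (skewOf (N := N)).map_zero, unskew_skewOf]

/-- `unskew` is continuous. [folklore] -/
theorem continuous_unskew : Continuous (unskew (N := N)) := by
  unfold unskew
  fun_prop

/-- `unskew` is `2`-Lipschitz... we only need: `‖unskew X - unskew Y‖ = ‖X - Y‖` for
skew-Hermitian `X, Y`. [folklore] -/
theorem norm_unskew_sub_unskew {X Y : 𝕄} (hX : Xᴴ = -X) (hY : Yᴴ = -Y) :
    ‖unskew X - unskew Y‖ = ‖X - Y‖ := by
  conv_rhs => rw [← skewOf_unskew hX, ← skewOf_unskew hY, ← map_sub, LinearIsometry.norm_map]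

/-! ### The chart and its inverse -/

variable (N) in
/-- The unitary group `U(N)`. [folklore] -/
abbrev 𝔾 : Type := Matrix.unitaryGroup (Fin N) ℂ

/-- The Cayley chart `ℝ^{N²} → U(N)`, `a ↦ (2 + X)(2 - X)⁻¹`, `X = skewOf a`. [folklore] -/
def chart (a : 𝔼 N) : 𝔾 N := ⟨cay (skewOf a), cay_mem_unitaryGroup (conjTranspose_skewOf a)⟩

/-- The matrix of `chart a` is `cay (skewOf a)`. [folklore] -/
@[simp] theorem coe_chart (a : 𝔼 N) : (chart a : 𝕄) = cay (skewOf a) := rfl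

/-- `chart 0 = 1`. [folklore] -/
@[simp] theorem chart_zero : chart (0 : 𝔼 N) = 1 := by
  ext1; simp

/-- The inverse chart `U ↦ unskew (2 (U - 1)(U + 1)⁻¹)` (a left inverse of `chart`, and a
right inverse on `‖U - 1‖ < 2`). [folklore] -/
def ichart (U : 𝔾 N) : 𝔼 N := unskew (icay (U : 𝕄))

/-- `ichart` is a left inverse of `chart`. [folklore] -/
@[simp] theorem ichart_chart (a : 𝔼 N) : ichart (chart a) = a := by
  rw [ichart, coe_chart, icay_cay (conjTranspose_skewOf a), unskew_skewOf]

/-- `chart (ichart U) = U` when `‖U - 1‖ < 2`. [folklore] -/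
theorem chart_ichart {U : 𝔾 N} (hU : ‖(U : 𝕄) - 1‖ < 2) : chart (ichart U) = U := by
  ext1
  rw [coe_chart, ichart, skewOf_unskew (conjTranspose_icay U.2 hU), cay_icay U.2 hU]

/-- The chart is injective. [folklore] -/
theorem chart_injective : Function.Injective (chart (N := N)) :=
  Function.LeftInverse.injective ichart_chart

/-- The chart is `1`-Lipschitz into the Frobenius norm. [folklore] -/
theorem norm_chart_sub_chart_le (a b : 𝔼 N) : ‖(chart a : 𝕄) - chart b‖ ≤ ‖a - b‖ := by
  rw [coe_chart, coe_chart, ← (skewOf (N := N)).norm_map (a - b), map_sub]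
  exact norm_cay_sub_cay_le (conjTranspose_skewOf a) (conjTranspose_skewOf b)

/-- `‖chart a - 1‖ ≤ ‖a‖`. [folklore] -/
theorem norm_chart_sub_one_le (a : 𝔼 N) : ‖(chart a : 𝕄) - 1‖ ≤ ‖a‖ := by
  simpa using norm_chart_sub_chart_le a 0

/-- The chart is `1`-Lipschitz (as a map into matrices). [folklore] -/
theorem lipschitzWith_coe_chart : LipschitzWith 1 (fun a : 𝔼 N => (chart a : 𝕄)) :=
  LipschitzWith.of_dist_le_mul fun a b => by
    simp only [NNReal.coe_one, one_mul, dist_eq_norm]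
    exact norm_chart_sub_chart_le a b

/-- The chart is continuous. [folklore] -/
theorem continuous_chart : Continuous (chart (N := N)) :=
  Continuous.subtype_mk lipschitzWith_coe_chart.continuous _

/-- Inverse Lipschitz bound of the chart. [folklore] -/
theorem norm_sub_le_norm_chart_sub_chart (a b : 𝔼 N) :
    ‖a - b‖ ≤ (1 + ‖a‖ / 2) * (1 + ‖b‖ / 2) * ‖(chart a : 𝕄) - chart b‖ := by
  have h := norm_sub_le_norm_cay_sub_cay (conjTranspose_skewOf a) (conjTranspose_skewOf b)
  rwa [← map_sub, LinearIsometry.norm_map, LinearIsometry.norm_map, LinearIsometry.norm_map] at h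

/-- Size of the inverse chart: `(2 - ‖U - 1‖) ‖ichart U‖ ≤ 2 ‖U - 1‖`. [folklore] -/
theorem norm_ichart_le {U : 𝔾 N} (hU : ‖(U : 𝕄) - 1‖ < 2) :
    (2 - ‖(U : 𝕄) - 1‖) * ‖ichart U‖ ≤ 2 * ‖(U : 𝕄) - 1‖ := by
  have h := norm_icay_le hU
  rwa [ichart, ← sub_zero (unskew _), ← unskew_zero,
    norm_unskew_sub_unskew (conjTranspose_icay U.2 hU) (by simp), sub_zero]

/-! ### Haar measure of `U(N)` in the chart: the ball squeeze -/

section Measure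

open MeasureTheory Measure Metric Filter Topology Set
open scoped ENNReal NNReal

/-- `U(N) ⊆ M_N(ℂ)` is second countable. [folklore] -/
instance secondCountable_𝔾 : SecondCountableTopology (𝔾 N) := by
  haveI : SecondCountableTopology (Matrix (Fin N) (Fin N) ℂ) :=
    inferInstanceAs (SecondCountableTopology (Fin N → Fin N → ℂ))
  exact Topology.IsEmbedding.subtypeVal.secondCountableTopology

/-- The Cayley chart is a measurable embedding (continuous and injective on the Polish space
`ℝ^{N²}`; Lusin–Souslin). [folklore] -/
theorem measurableEmbedding_chart : MeasurableEmbedding (chart (N := N)) :=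
  continuous_chart.measurableEmbedding chart_injective

/-- The pull-back `ν(A) = σ(chart(A))` of the Haar probability measure `σ` of `U(N)` to the
parameter space of the chart (Chatterjee arXiv:1602.01222 §11, the measure `ν`). [cite: arXiv160201222, §11] -/
def chartMeasure (N : ℕ) : Measure (𝔼 N) := Measure.comap chart (haarProbability (𝔾 N))

/-- `ν(A) = σ(chart(A))` for every set `A`. [folklore] -/
theorem chartMeasure_apply (A : Set (𝔼 N)) :
    chartMeasure N A = haarProbability (𝔾 N) (chart '' A) :=
  measurableEmbedding_chart.comap_apply _ _

/-- `ν` is a finite measure. [folklore] -/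
instance isFiniteMeasure_chartMeasure : IsFiniteMeasure (chartMeasure N) :=
  ⟨by rw [chartMeasure_apply]; exact measure_lt_top _ _⟩

variable (N) in
/-- The closed Hilbert–Schmidt ball `B(1, δ) = {U : ‖U - 1‖_F ≤ δ}` in `U(N)`
(Chatterjee arXiv:1602.01222 §11, `B(U, r)`). [cite: arXiv160201222, §11] -/
def gball (δ : ℝ) : Set (𝔾 N) := {U | ‖(U : 𝕄) - 1‖ ≤ δ}

/-- Membership in `B(1, δ)`. [folklore] -/
theorem mem_gball {δ : ℝ} {U : 𝔾 N} : U ∈ gball N δ ↔ ‖(U : 𝕄) - 1‖ ≤ δ := Iff.rfl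

/-- `U ↦ ‖U - V‖` is continuous on `U(N)`. [folklore] -/
theorem continuous_norm_coe_sub (V : 𝕄) : Continuous fun U : 𝔾 N => ‖(U : 𝕄) - V‖ :=
  (continuous_subtype_val.sub continuous_const).norm

/-- `B(1, δ)` is closed. [folklore] -/
theorem isClosed_gball (δ : ℝ) : IsClosed (gball N δ) :=
  isClosed_le (continuous_norm_coe_sub 1) continuous_const

/-- `B(1, δ)` is measurable. [folklore] -/
theorem measurableSet_gball (δ : ℝ) : MeasurableSet (gball N δ) :=
  (isClosed_gball δ).measurableSet

/-- `B(1, δ)` is monotone in `δ`. [folklore] -/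
theorem gball_mono {δ δ' : ℝ} (h : δ ≤ δ') : gball N δ ⊆ gball N δ' := fun _ hU => le_trans hU h

/-- Haar measure charges every ball `B(1, δ)`, `δ > 0`. [folklore] -/
theorem haar_gball_pos {δ : ℝ} (hδ : 0 < δ) : 0 < haarProbability (𝔾 N) (gball N δ) := by
  have ho : IsOpen {U : 𝔾 N | ‖(U : 𝕄) - 1‖ < δ} :=
    isOpen_lt (continuous_norm_coe_sub 1) continuous_const
  refine lt_of_lt_of_le (ho.measure_pos (haarProbability (𝔾 N)) ⟨1, by simpa using hδ⟩) ?_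
  exact measure_mono fun U (hU : ‖(U : 𝕄) - 1‖ < δ) => hU.le

/-- Hilbert–Schmidt distances on `U(N)` are left invariant:
`‖U - V‖ = ‖V⁻¹ U - 1‖` (Chatterjee arXiv:1602.01222 Lemma 11.5). [cite: arXiv160201222, Lemma 11.5] -/
theorem norm_coe_sub_coe (U V : 𝔾 N) : ‖(U : 𝕄) - V‖ = ‖((V⁻¹ * U : 𝔾 N) : 𝕄) - 1‖ := by
  have hV : ((V⁻¹ : 𝔾 N) : 𝕄) * (V : 𝕄) = 1 := by
    rw [← Submonoid.coe_mul, inv_mul_cancel]; rfl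
  have e : ((V⁻¹ * U : 𝔾 N) : 𝕄) - 1 = ((V⁻¹ : 𝔾 N) : 𝕄) * ((U : 𝕄) - V) := by
    rw [Matrix.mul_sub, hV, Submonoid.coe_mul]
  rw [e, Matrix.frobenius_norm_unitaryGroup_mul]

/-- The ball around `V` is the left translate of the ball around `1`. [folklore] -/
theorem setOf_norm_sub_le_eq_preimage (V : 𝔾 N) (δ : ℝ) :
    {U : 𝔾 N | ‖(U : 𝕄) - V‖ ≤ δ} = (fun U => V⁻¹ * U) ⁻¹' gball N δ := by
  ext U
  simp only [mem_setOf_eq, mem_preimage, mem_gball, norm_coe_sub_coe U V]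

/-- Haar measure of the ball around `V` equals that of the ball around `1`
(Chatterjee arXiv:1602.01222 Lemma 11.5). [cite: arXiv160201222, Lemma 11.5] -/
theorem haar_setOf_norm_sub_le (V : 𝔾 N) (δ : ℝ) :
    haarProbability (𝔾 N) {U : 𝔾 N | ‖(U : 𝕄) - V‖ ≤ δ} = haarProbability (𝔾 N) (gball N δ) := by
  rw [setOf_norm_sub_le_eq_preimage, measure_preimage_mul]

/-- Chart balls are contained in group balls of the same radius (the chart is `1`-Lipschitz;
Chatterjee arXiv:1602.01222 Cor. 11.3, second inclusion). [cite: arXiv160201222, Cor. 11.3] -/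
theorem image_chart_closedBall_subset (a : 𝔼 N) (δ : ℝ) :
    chart '' closedBall a δ ⊆ {U : 𝔾 N | ‖(U : 𝕄) - chart a‖ ≤ δ} := by
  rintro _ ⟨b, hb, rfl⟩
  rw [mem_closedBall, dist_eq_norm] at hb
  exact (norm_chart_sub_chart_le b a).trans hb

/-- The distortion factor `κ(r) = (1 + 2r)(1 + r/2)` of the chart at scale `r`. [folklore] -/
def κ (r : ℝ) : ℝ := (1 + 2 * r) * (1 + r / 2)

/-- `1 ≤ κ(r)` for `r ≥ 0`. [folklore] -/
theorem one_le_κ {r : ℝ} (hr : 0 ≤ r) : 1 ≤ κ r := by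
  unfold κ; nlinarith

/-- `0 < κ(r)` for `r ≥ 0`. [folklore] -/
theorem κ_pos {r : ℝ} (hr : 0 ≤ r) : 0 < κ r := lt_of_lt_of_le one_pos (one_le_κ hr)

/-- `κ` is continuous. [folklore] -/
theorem continuous_κ : Continuous κ := by unfold κ; fun_prop

/-- `κ(0) = 1`. [folklore] -/
theorem κ_zero : κ 0 = 1 := by norm_num [κ]

/-- Group balls of radius `δ/κ(r)` around `chart a` are contained in the chart image of the
ball of radius `δ` around `a`, for `‖a‖ ≤ r ≤ 1/2`, `δ ≤ r` (Chatterjee arXiv:1602.01222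
Cor. 11.3, first inclusion, for the Cayley chart). [cite: arXiv160201222, Cor. 11.3] -/
theorem setOf_norm_sub_le_subset_image_chart {r δ : ℝ} (hr : r ≤ 1 / 2) {a : 𝔼 N}
    (ha : ‖a‖ ≤ r) (hδ : 0 ≤ δ) (hδr : δ ≤ r) :
    {U : 𝔾 N | ‖(U : 𝕄) - chart a‖ ≤ δ / κ r} ⊆ chart '' closedBall a δ := by
  intro U hU
  rw [mem_setOf_eq] at hU
  have hr0 : 0 ≤ r := hδ.trans hδr
  have hκ := one_le_κ hr0
  have hδκ : δ / κ r ≤ δ := div_le_self hδ hκ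
  have hU1 : ‖(U : 𝕄) - 1‖ ≤ 2 * r := by
    calc ‖(U : 𝕄) - 1‖ = ‖((U : 𝕄) - chart a) + ((chart a : 𝕄) - 1)‖ := by rw [sub_add_sub_cancel]
      _ ≤ ‖(U : 𝕄) - chart a‖ + ‖(chart a : 𝕄) - 1‖ := norm_add_le _ _
      _ ≤ δ + ‖a‖ := add_le_add (hU.trans hδκ) (norm_chart_sub_one_le a)
      _ ≤ 2 * r := by linarith
  have hU2 : ‖(U : 𝕄) - 1‖ < 2 := by linarith
  set b := ichart U with hb
  have hbU : chart b = U := chart_ichart hU2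
  have hbn : ‖b‖ ≤ 4 * r := by
    have h := norm_ichart_le hU2
    rw [← hb] at h
    nlinarith [norm_nonneg b, norm_nonneg ((U : 𝕄) - 1)]
  refine ⟨b, ?_, hbU⟩
  rw [mem_closedBall, dist_eq_norm]
  have h := norm_sub_le_norm_chart_sub_chart b a
  rw [hbU] at h
  have hf : (1 + ‖b‖ / 2) * (1 + ‖a‖ / 2) ≤ κ r := by
    unfold κ
    apply mul_le_mul <;> nlinarith [norm_nonneg a, norm_nonneg b]
  calc ‖b - a‖ ≤ (1 + ‖b‖ / 2) * (1 + ‖a‖ / 2) * ‖(U : 𝕄) - chart a‖ := h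
    _ ≤ κ r * (δ / κ r) := mul_le_mul hf hU (norm_nonneg _) (by linarith)
    _ = δ := mul_div_cancel₀ δ (by linarith)

/-- **Ball squeeze, upper half**: `ν(b(a, δ)) ≤ σ(B(1, δ))`. [cite: arXiv160201222, §11 (proof of Thm. 11.1)] -/
theorem chartMeasure_closedBall_le (a : 𝔼 N) (δ : ℝ) :
    chartMeasure N (closedBall a δ) ≤ haarProbability (𝔾 N) (gball N δ) := by
  rw [chartMeasure_apply, ← haar_setOf_norm_sub_le (chart a)]
  exact measure_mono (image_chart_closedBall_subset a δ)

/-- **Ball squeeze, lower half**: `σ(B(1, δ/κ(r))) ≤ ν(b(a, δ))` for `‖a‖ ≤ r ≤ 1/2`,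
`0 ≤ δ ≤ r`. [cite: arXiv160201222, §11 (proof of Thm. 11.1)] -/
theorem haar_gball_le_chartMeasure_closedBall {r δ : ℝ} (hr : r ≤ 1 / 2) {a : 𝔼 N}
    (ha : ‖a‖ ≤ r) (hδ : 0 ≤ δ) (hδr : δ ≤ r) :
    haarProbability (𝔾 N) (gball N (δ / κ r)) ≤ chartMeasure N (closedBall a δ) := by
  rw [chartMeasure_apply, ← haar_setOf_norm_sub_le (chart a)]
  exact measure_mono (setOf_norm_sub_le_subset_image_chart hr ha hδ hδr)

/-- The dimension `N²` of `U(N)`. [folklore] -/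
theorem finrank_𝔼 : Module.finrank ℝ (𝔼 N) = N * N := by
  rw [finrank_euclideanSpace, Fintype.card_prod, Fintype.card_fin]

/-- Lebesgue measure of Euclidean balls: `vol b(a, δ) = δ^{N²} vol b(0, 1)`. [folklore] -/
theorem volume_closedBall_𝔼 (a : 𝔼 N) {δ : ℝ} (hδ : 0 ≤ δ) :
    volume (closedBall a δ) = ENNReal.ofReal (δ ^ (N * N)) * volume (closedBall (0 : 𝔼 N) 1) := by
  rw [Measure.addHaar_closedBall' volume a hδ, finrank_𝔼]

/-- Euclidean balls of positive radius have positive volume. [folklore] -/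
theorem volume_closedBall_𝔼_pos (a : 𝔼 N) {δ : ℝ} (hδ : 0 < δ) : 0 < volume (closedBall a δ) :=
  Metric.measure_closedBall_pos volume a hδ

/-- Euclidean balls have finite volume. [folklore] -/
theorem volume_closedBall_𝔼_lt_top (a : 𝔼 N) (δ : ℝ) : volume (closedBall a δ) < ∞ :=
  measure_closedBall_lt_top

end Measure

/-! ### The small-ball limit `σ(B(1,δ)) ~ c δ^{N²}` -/

section Limit

open MeasureTheory Measure Metric Filter Topology Set
open scoped ENNReal NNReal Topology

variable (N) in
/-- The small-ball ratio `g(δ) = σ(B(1, δ)) / vol(b(0, δ))` (Haar measure of the Hilbert–Schmidt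
ball of `U(N)` over the Lebesgue measure of the Euclidean ball of `ℝ^{N²}`), whose limit as
`δ → 0` replaces the explicit constant of Chatterjee arXiv:1602.01222 Thm. 6.1. [cite: arXiv160201222, Thm. 6.1 (analogue)] -/
def ballRatio (δ : ℝ) : ℝ≥0∞ :=
  haarProbability (𝔾 N) (gball N δ) / volume (closedBall (0 : 𝔼 N) δ)

/-- `ν(b(a,δ))/vol(b(a,δ)) ≤ g(δ)`. [cite: arXiv160201222, §11 (proof of Thm. 11.1)] -/
theorem ratio_le_ballRatio (a : 𝔼 N) (δ : ℝ) :
    chartMeasure N (closedBall a δ) / volume (closedBall a δ) ≤ ballRatio N δ := by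
  rw [ballRatio, ← Measure.addHaar_closedBall_center volume a δ]
  exact ENNReal.div_le_div_right (chartMeasure_closedBall_le a δ) _

/-- Scaling of Euclidean balls. [folklore] -/
theorem volume_closedBall_mul (a : 𝔼 N) {k δ : ℝ} (hk : 0 < k) (hδ : 0 ≤ δ) :
    volume (closedBall a (k * δ)) = ENNReal.ofReal (k ^ (N * N)) * volume (closedBall a δ) := by
  rw [volume_closedBall_𝔼 a (by positivity), volume_closedBall_𝔼 a hδ, mul_pow,
    ENNReal.ofReal_mul (by positivity), mul_assoc]

/-- `g(t) ≤ κ(r)^{N²} ν(b(a, κ(r) t))/vol(b(a, κ(r) t))` for `‖a‖ ≤ r ≤ 1/2`, `κ(r) t ≤ r`.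
[cite: arXiv160201222, §11 (proof of Thm. 11.1)] -/
theorem ballRatio_le {r t : ℝ} (hr : r ≤ 1 / 2) {a : 𝔼 N} (ha : ‖a‖ ≤ r) (ht : 0 < t)
    (htr : κ r * t ≤ r) :
    ballRatio N t ≤ ENNReal.ofReal (κ r ^ (N * N)) *
      (chartMeasure N (closedBall a (κ r * t)) / volume (closedBall a (κ r * t))) := by
  have hr0 : 0 ≤ r := (norm_nonneg a).trans ha
  have hκ := κ_pos hr0
  have h := haar_gball_le_chartMeasure_closedBall hr ha (by positivity : 0 ≤ κ r * t) htr
  rw [mul_div_cancel_left₀ t hκ.ne'] at h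
  have hK0 : ENNReal.ofReal (κ r ^ (N * N)) ≠ 0 := by
    rw [ENNReal.ofReal_ne_zero_iff]; positivity
  rw [ballRatio, ← Measure.addHaar_closedBall_center volume a t,
    ← ENNReal.mul_div_mul_left (haarProbability (𝔾 N) (gball N t)) (volume (closedBall a t)) hK0
      ENNReal.ofReal_ne_top, ← volume_closedBall_mul a hκ ht.le, mul_div_assoc]
  gcongr

/-- `t ↦ k t` maps `𝓝[>] 0` to itself for `k > 0`. [folklore] -/
theorem tendsto_const_mul_nhdsGT {k : ℝ} (hk : 0 < k) :
    Tendsto (fun t : ℝ => k * t) (𝓝[>] 0) (𝓝[>] 0) := by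
  refine tendsto_nhdsWithin_iff.2 ⟨?_, ?_⟩
  · have h : Tendsto (fun t : ℝ => k * t) (𝓝 0) (𝓝 (k * 0)) := tendsto_id.const_mul k
    rw [mul_zero] at h
    exact h.mono_left nhdsWithin_le_nhds
  · filter_upwards [self_mem_nhdsWithin] with t ht
    exact mul_pos hk ht

/-- Almost every point (for Lebesgue measure) is a point of density of `ν` with finite
derivative; since balls have positive volume, such points exist in every ball. [folklore] -/
theorem exists_good_point {r : ℝ} (hr : 0 < r) :
    ∃ a : 𝔼 N, ‖a‖ ≤ r ∧ ∃ R : ℝ≥0∞, R < ∞ ∧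
      Tendsto (fun δ => chartMeasure N (closedBall a δ) / volume (closedBall a δ))
        (𝓝[>] 0) (𝓝 R) := by
  have h1 := Besicovitch.ae_tendsto_rnDeriv (chartMeasure N) (volume : Measure (𝔼 N))
  have h2 := Measure.rnDeriv_lt_top (chartMeasure N) (volume : Measure (𝔼 N))
  have h := h1.and h2
  by_contra hcon
  push Not at hcon
  have hsub : closedBall (0 : 𝔼 N) r ⊆ {a | ¬ (Tendsto (fun δ => chartMeasure N (closedBall a δ) /
      volume (closedBall a δ)) (𝓝[>] 0) (𝓝 ((chartMeasure N).rnDeriv volume a)) ∧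
      (chartMeasure N).rnDeriv volume a < ∞)} := by
    intro a ha
    rw [mem_closedBall, dist_zero_right] at ha
    rintro ⟨hT, hF⟩
    exact hcon a ha _ hF hT
  have h0 : volume (closedBall (0 : 𝔼 N) r) = 0 :=
    measure_mono_null hsub (ae_iff.1 h)
  exact absurd h0 (volume_closedBall_𝔼_pos 0 hr).ne'

/-- **Existence of the small-ball constant.** The ratio `g(δ) = σ(B(1,δ))/vol(b(0,δ))` has a
limit `c ∈ (0, ∞)` as `δ → 0⁺` (a soft replacement of Chatterjee arXiv:1602.01222 Thm. 6.1,
where `c` is computed by the Weyl integration formula: here Lebesgue's differentiation of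
measures at one density point of `ν` and the ball squeeze show `limsup g ≤ κ(r)^{N²} liminf g`
for every `r`, and a Vitali covering argument shows `c > 0`). [cite: arXiv160201222, Thm. 6.1 (analogue)] -/
theorem exists_tendsto_ballRatio :
    ∃ c : ℝ≥0∞, c ≠ 0 ∧ c ≠ ∞ ∧ Tendsto (ballRatio N) (𝓝[>] 0) (𝓝 c) := by
  set g := ballRatio N with hg
  set M := limsup g (𝓝[>] 0) with hM
  set L := liminf g (𝓝[>] 0) with hL
  -- Step 1: from a good point at scale `r`: `R ≤ L` and `M ≤ κ(r)^{N²} R`.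
  have key : ∀ r : ℝ, 0 < r → r ≤ 1 / 2 →
      ∃ R : ℝ≥0∞, R < ∞ ∧ R ≤ L ∧ M ≤ ENNReal.ofReal (κ r ^ (N * N)) * R := by
    intro r hr hr2
    obtain ⟨a, ha, R, hRfin, hR⟩ := exists_good_point (N := N) hr
    have hκ := κ_pos hr.le
    refine ⟨R, hRfin, ?_, ?_⟩
    · -- `Ratio(a, δ) ≤ g(δ)` eventually, so `R = liminf Ratio ≤ liminf g`
      rw [← hR.liminf_eq]
      exact liminf_le_liminf (Eventually.of_forall fun δ => ratio_le_ballRatio a δ)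
    · -- `g(t) ≤ κ^{N²} Ratio(a, κ t)` for small `t`, and the right side tends to `κ^{N²} R`
      have hT : Tendsto (fun t => ENNReal.ofReal (κ r ^ (N * N)) *
          (chartMeasure N (closedBall a (κ r * t)) / volume (closedBall a (κ r * t))))
          (𝓝[>] 0) (𝓝 (ENNReal.ofReal (κ r ^ (N * N)) * R)) :=
        ENNReal.Tendsto.const_mul (hR.comp (tendsto_const_mul_nhdsGT hκ)) (Or.inr ENNReal.ofReal_ne_top)
      rw [← hT.limsup_eq]
      refine limsup_le_limsup ?_
      filter_upwards [Ioc_mem_nhdsGT (show (0 : ℝ) < r / κ r from div_pos hr hκ)] with t ht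
      exact ballRatio_le hr2 ha ht.1 (by rw [← le_div_iff₀' hκ]; exact ht.2)
  -- Step 2: `M < ∞` and `M ≤ L`.
  obtain ⟨R₀, hR₀fin, -, hMR₀⟩ := key (1 / 2) (by norm_num) le_rfl
  have hMfin : M < ∞ := lt_of_le_of_lt hMR₀ (ENNReal.mul_lt_top ENNReal.ofReal_lt_top hR₀fin)
  have hLM : L ≤ M := liminf_le_limsup
  have hLfin : L < ∞ := lt_of_le_of_lt hLM hMfin
  have hML : M ≤ L := by
    -- in real numbers: `M ≤ κ(r)^{N²} L` for all small `r`, and `κ(r) → 1`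
    have hreal : ∀ r : ℝ, 0 < r → r ≤ 1 / 2 → M.toReal ≤ κ r ^ (N * N) * L.toReal := by
      intro r hr hr2
      obtain ⟨R, -, hRL, hMR⟩ := key r hr hr2
      have h1 : M ≤ ENNReal.ofReal (κ r ^ (N * N)) * L := hMR.trans (by gcongr)
      have h2 := ENNReal.toReal_mono (ENNReal.mul_ne_top ENNReal.ofReal_ne_top hLfin.ne) h1
      rwa [ENNReal.toReal_mul, ENNReal.toReal_ofReal (pow_nonneg (κ_pos hr.le).le _)] at h2
    have hlim : Tendsto (fun r : ℝ => κ r ^ (N * N) * L.toReal) (𝓝[>] 0) (𝓝 (κ 0 ^ (N * N) * L.toReal)) :=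
      ((continuous_κ.pow _).mul continuous_const).continuousAt.tendsto.mono_left nhdsWithin_le_nhds
    rw [κ_zero, one_pow, one_mul] at hlim
    have hle : M.toReal ≤ L.toReal :=
      ge_of_tendsto hlim (by
        filter_upwards [Ioc_mem_nhdsGT (show (0 : ℝ) < 1 / 2 by norm_num)] with r hr
        exact hreal r hr.1 hr.2)
    exact (ENNReal.toReal_le_toReal hMfin.ne hLfin.ne).1 hle
  -- Step 3: the limit exists and equals `M`.
  have hT : Tendsto g (𝓝[>] 0) (𝓝 M) := tendsto_of_le_liminf_of_limsup_le hML le_rfl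
  refine ⟨M, ?_, hMfin.ne, hT⟩
  -- Step 4: `M ≠ 0` by a Vitali covering argument on the ball `b(0, 1/2)`.
  intro hM0
  rw [hM0] at hT
  set S : Set (𝔼 N) := closedBall 0 (1 / 2) with hS
  have hSpos : 0 < chartMeasure N S := by
    have h := haar_gball_le_chartMeasure_closedBall (N := N) (r := 1 / 2) (δ := 1 / 2) le_rfl
      (a := 0) (by norm_num) (by norm_num) le_rfl
    exact lt_of_lt_of_le (haar_gball_pos (div_pos one_half_pos (κ_pos (by norm_num)))) h
  have hSfin : volume S ≠ ∞ := (volume_closedBall_𝔼_lt_top _ _).ne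
  obtain ⟨ε, hε, hεS⟩ := ENNReal.exists_nnreal_pos_mul_lt hSfin hSpos.ne'
  -- every point of `S` has arbitrarily small balls with `ν ≤ ε vol`
  have hfreq : ∀ x ∈ S, ∃ᶠ t in (Besicovitch.vitaliFamily (chartMeasure N)).filterAt x,
      chartMeasure N t ≤ (ε • (volume : Measure (𝔼 N))) t := by
    intro x _
    have hev : ∀ᶠ δ in 𝓝[>] (0 : ℝ), chartMeasure N (closedBall x δ) ≤
        (ε • (volume : Measure (𝔼 N))) (closedBall x δ) := by
      filter_upwards [hT.eventually_lt_const (show (0 : ℝ≥0∞) < ε by exact_mod_cast hε),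
        self_mem_nhdsWithin] with δ hδ hδ0
      have h := (ratio_le_ballRatio x δ).trans_lt hδ
      rw [ENNReal.div_lt_iff (Or.inl (volume_closedBall_𝔼_pos x hδ0).ne')
        (Or.inl (volume_closedBall_𝔼_lt_top x δ).ne)] at h
      rw [Measure.coe_nnreal_smul_apply]
      exact h.le
    exact (Besicovitch.tendsto_filterAt (chartMeasure N) x).frequently hev.frequently
  have hle := (Besicovitch.vitaliFamily (chartMeasure N)).measure_le_of_frequently_le
    (ε • (volume : Measure (𝔼 N))) Measure.AbsolutelyContinuous.rfl S hfreq
  rw [Measure.coe_nnreal_smul_apply] at hle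
  exact absurd hle (not_le.2 hεS)

end Limit

/-! ### The Haar density constant and the comparison of measures -/

section Comparison

open MeasureTheory Measure Metric Filter Topology Set
open scoped ENNReal NNReal Topology

variable (N) in
/-- **The Haar density constant** `c_N ∈ (0, ∞)` of `U(N)` in the Cayley chart:
`c_N = lim_{δ→0} σ(B(1,δ)) / vol(b(0,δ))`; it plays the role of Chatterjee's
`C_N Γ(N²/2+1)^{-1} π^{N²/2}·…` (arXiv:1602.01222 Thm. 6.1 / Thm. 11.1) but is not computed
here. [cite: arXiv160201222, Thm. 11.1 (analogue)] -/
def haarChartConst : ℝ≥0 := (Classical.choose (exists_tendsto_ballRatio (N := N))).toNNReal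

/-- Defining property of `haarChartConst`. [folklore] -/
theorem haarChartConst_spec :
    (haarChartConst N : ℝ≥0∞) ≠ 0 ∧ Tendsto (ballRatio N) (𝓝[>] 0) (𝓝 (haarChartConst N)) := by
  have h := Classical.choose_spec (exists_tendsto_ballRatio (N := N))
  rw [haarChartConst, ENNReal.coe_toNNReal h.2.1]
  exact ⟨h.1, h.2.2⟩

/-- `0 < c_N`. [folklore] -/
theorem haarChartConst_pos : 0 < haarChartConst N := by
  have h := haarChartConst_spec (N := N)
  exact pos_iff_ne_zero.2 fun h0 => h.1 (by rw [h0, ENNReal.coe_zero])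

/-- `σ(B(1,δ))/vol(b(0,δ)) → c_N` as `δ → 0⁺`. [cite: arXiv160201222, Thm. 6.1 (analogue)] -/
theorem tendsto_ballRatio : Tendsto (ballRatio N) (𝓝[>] 0) (𝓝 (haarChartConst N)) :=
  haarChartConst_spec.2

/-- **Upper comparison**: `ν(s) ≤ c_N vol(s)` for every `s` (the upper ball squeeze needs no
constraint on the centre; Chatterjee arXiv:1602.01222 Thm. 11.1, upper bound, for the Cayley
chart and with the soft constant). [cite: arXiv160201222, Thm. 11.1 (analogue)] -/
theorem chartMeasure_le (s : Set (𝔼 N)) :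
    chartMeasure N s ≤ haarChartConst N * volume s := by
  -- for every `k > c_N`, `ν s ≤ k vol s` by the Vitali covering lemma
  have hk : ∀ k : ℝ≥0, haarChartConst N < k → chartMeasure N s ≤ k * volume s := by
    intro k hk
    have hfreq : ∀ x ∈ s, ∃ᶠ t in (Besicovitch.vitaliFamily (chartMeasure N)).filterAt x,
        chartMeasure N t ≤ (k • (volume : Measure (𝔼 N))) t := by
      intro x _
      have hev : ∀ᶠ δ in 𝓝[>] (0 : ℝ), chartMeasure N (closedBall x δ) ≤
          (k • (volume : Measure (𝔼 N))) (closedBall x δ) := by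
        filter_upwards [tendsto_ballRatio.eventually_lt_const (show (haarChartConst N : ℝ≥0∞) < k by
          exact_mod_cast hk), self_mem_nhdsWithin] with δ hδ hδ0
        have h := (ratio_le_ballRatio x δ).trans_lt hδ
        rw [ENNReal.div_lt_iff (Or.inl (volume_closedBall_𝔼_pos x hδ0).ne')
          (Or.inl (volume_closedBall_𝔼_lt_top x δ).ne)] at h
        rw [Measure.coe_nnreal_smul_apply]
        exact h.le
      exact (Besicovitch.tendsto_filterAt (chartMeasure N) x).frequently hev.frequently
    have hle := (Besicovitch.vitaliFamily (chartMeasure N)).measure_le_of_frequently_le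
      (k • (volume : Measure (𝔼 N))) Measure.AbsolutelyContinuous.rfl s hfreq
    rwa [Measure.coe_nnreal_smul_apply] at hle
  refine ENNReal.le_of_forall_lt_one_mul_le fun a ha => ?_
  rcases eq_or_ne a 0 with rfl | ha0
  · simp
  have hafin : a ≠ ∞ := ne_top_of_lt ha
  set a' : ℝ≥0 := a.toNNReal with ha'
  have haa : (a' : ℝ≥0∞) = a := ENNReal.coe_toNNReal hafin
  have ha'0 : a' ≠ 0 := by
    intro h; rw [h, ENNReal.coe_zero] at haa; exact ha0 haa.symm
  have ha'1 : a' < 1 := by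
    rw [← ENNReal.coe_lt_coe, haa, ENNReal.coe_one]; exact ha
  have hk' : haarChartConst N < haarChartConst N / a' :=
    lt_div_iff₀ (pos_iff_ne_zero.2 ha'0) |>.2 (mul_lt_of_lt_one_right haarChartConst_pos ha'1)
  calc a * chartMeasure N s ≤ a * ((haarChartConst N / a' : ℝ≥0) * volume s) := by
        gcongr; exact hk _ hk'
    _ = haarChartConst N * volume s := by
        rw [← mul_assoc, ← haa, ← ENNReal.coe_mul, mul_div_cancel₀ _ ha'0]

/-- `κ(r)^{-N²} g(δ/κ(r)) ≤ ν(b(x,δ))/vol(b(x,δ))` for `‖x‖ ≤ r ≤ 1/2`, `0 < δ ≤ r`. [cite: arXiv160201222, §11 (proof of Thm. 11.1)] -/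
theorem inv_mul_ballRatio_le {r δ : ℝ} (hr : r ≤ 1 / 2) {x : 𝔼 N} (hx : ‖x‖ ≤ r) (hδ : 0 < δ)
    (hδr : δ ≤ r) :
    (ENNReal.ofReal (κ r ^ (N * N)))⁻¹ * ballRatio N (δ / κ r) ≤
      chartMeasure N (closedBall x δ) / volume (closedBall x δ) := by
  have hr0 : 0 ≤ r := (norm_nonneg x).trans hx
  have hκ := κ_pos hr0
  have h := ballRatio_le hr hx (div_pos hδ hκ) (by rw [mul_div_cancel₀ _ hκ.ne']; exact hδr)
  rw [mul_div_cancel₀ _ hκ.ne'] at h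
  have hK0 : ENNReal.ofReal (κ r ^ (N * N)) ≠ 0 := by
    rw [ENNReal.ofReal_ne_zero_iff]; positivity
  calc (ENNReal.ofReal (κ r ^ (N * N)))⁻¹ * ballRatio N (δ / κ r)
      ≤ (ENNReal.ofReal (κ r ^ (N * N)))⁻¹ * (ENNReal.ofReal (κ r ^ (N * N)) *
          (chartMeasure N (closedBall x δ) / volume (closedBall x δ))) := by gcongr
    _ = chartMeasure N (closedBall x δ) / volume (closedBall x δ) := by
        rw [← mul_assoc, ENNReal.inv_mul_cancel hK0 ENNReal.ofReal_ne_top, one_mul]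

variable (N) in
/-- The lower comparison constant `c_N κ(r)^{-N²}` at scale `r`. [folklore] -/
def lowerConst (r : ℝ) : ℝ≥0∞ := (ENNReal.ofReal (κ r ^ (N * N)))⁻¹ * haarChartConst N

/-- The lower constant is finite. [folklore] -/
theorem lowerConst_ne_top (r : ℝ) (hr : 0 ≤ r) : lowerConst N r ≠ ∞ := by
  refine ENNReal.mul_ne_top (ENNReal.inv_ne_top.2 ?_) ENNReal.coe_ne_top
  rw [ENNReal.ofReal_ne_zero_iff]; exact pow_pos (κ_pos hr) _

/-- The lower constant is non-zero. [folklore] -/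
theorem lowerConst_ne_zero (r : ℝ) : lowerConst N r ≠ 0 :=
  mul_ne_zero (ENNReal.inv_ne_zero.2 ENNReal.ofReal_ne_top) haarChartConst_spec.1

/-- **Lower comparison**: `c_N κ(r)^{-N²} vol(s) ≤ ν(s)` for every `s ⊆ b(0, r)`, `r ≤ 1/2`
(Chatterjee arXiv:1602.01222 Thm. 11.1, lower bound, for the Cayley chart and with the soft
constant). [cite: arXiv160201222, Thm. 11.1 (analogue)] -/
theorem le_chartMeasure_of_subset {r : ℝ} (hr : 0 < r) (hr2 : r ≤ 1 / 2) {s : Set (𝔼 N)}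
    (hs : s ⊆ closedBall 0 r) : lowerConst N r * volume s ≤ chartMeasure N s := by
  have hκ := κ_pos hr.le
  -- the comparison function tends to `lowerConst N r`
  have hT : Tendsto (fun δ => (ENNReal.ofReal (κ r ^ (N * N)))⁻¹ * ballRatio N (δ / κ r))
      (𝓝[>] 0) (𝓝 (lowerConst N r)) := by
    have hK0 : ENNReal.ofReal (κ r ^ (N * N)) ≠ 0 := by
      rw [ENNReal.ofReal_ne_zero_iff]; positivity
    refine ENNReal.Tendsto.const_mul (tendsto_ballRatio.comp ?_) (Or.inr (ENNReal.inv_ne_top.2 hK0))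
    simpa only [div_eq_inv_mul] using tendsto_const_mul_nhdsGT (inv_pos.2 hκ)
  -- for every `k < lowerConst`, `k vol s ≤ ν s` by the Vitali covering lemma (for Lebesgue measure)
  have hk : ∀ k : ℝ≥0, (k : ℝ≥0∞) < lowerConst N r → (k : ℝ≥0∞) * volume s ≤ chartMeasure N s := by
    intro k hk
    have hfreq : ∀ x ∈ s, ∃ᶠ t in (Besicovitch.vitaliFamily (volume : Measure (𝔼 N))).filterAt x,
        ((k : ℝ≥0∞) • (volume : Measure (𝔼 N))) t ≤ chartMeasure N t := by
      intro x hx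
      have hxr : ‖x‖ ≤ r := by simpa [mem_closedBall, dist_zero_right] using hs hx
      have hev : ∀ᶠ δ in 𝓝[>] (0 : ℝ), ((k : ℝ≥0∞) • (volume : Measure (𝔼 N))) (closedBall x δ) ≤
          chartMeasure N (closedBall x δ) := by
        filter_upwards [hT.eventually_const_lt hk, Ioc_mem_nhdsGT hr] with δ hδ hδr
        have h := hδ.trans_le (inv_mul_ballRatio_le hr2 hxr hδr.1 hδr.2)
        rw [ENNReal.lt_div_iff_mul_lt (Or.inl (volume_closedBall_𝔼_pos x hδr.1).ne')
          (Or.inl (volume_closedBall_𝔼_lt_top x δ).ne)] at h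
        rw [Measure.smul_apply, smul_eq_mul]
        exact h.le
      exact (Besicovitch.tendsto_filterAt volume x).frequently hev.frequently
    have hle := (Besicovitch.vitaliFamily (volume : Measure (𝔼 N))).measure_le_of_frequently_le
      (chartMeasure N) (smul_absolutelyContinuous (c := (k : ℝ≥0∞))) s hfreq
    rwa [Measure.smul_apply, smul_eq_mul] at hle
  refine ENNReal.le_of_forall_lt_one_mul_le fun a ha => ?_
  have hafin : a ≠ ∞ := ne_top_of_lt ha
  have hfin : a * lowerConst N r ≠ ∞ := ENNReal.mul_ne_top hafin (lowerConst_ne_top r hr.le)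
  rcases eq_or_ne a 0 with rfl | ha0
  · simp
  have hlt : a * lowerConst N r < lowerConst N r := by
    conv_rhs => rw [← one_mul (lowerConst N r)]
    exact ENNReal.mul_lt_mul_left (lowerConst_ne_zero r) (lowerConst_ne_top r hr.le) ha
  have h := hk (a * lowerConst N r).toNNReal (by rwa [ENNReal.coe_toNNReal hfin])
  rw [ENNReal.coe_toNNReal hfin] at h
  rwa [← mul_assoc]

/-- The comparisons as inequalities of restricted measures. [cite: arXiv160201222, Thm. 11.1 (analogue)] -/
theorem chartMeasure_restrict_le (B : Set (𝔼 N)) :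
    (chartMeasure N).restrict B ≤ haarChartConst N • (volume : Measure (𝔼 N)).restrict B := by
  refine Measure.le_iff.2 fun s hs => ?_
  rw [Measure.restrict_apply hs, Measure.coe_nnreal_smul_apply, Measure.restrict_apply hs]
  exact chartMeasure_le _

/-- Lower comparison of restricted measures on `b(0, r)`. [cite: arXiv160201222, Thm. 11.1 (analogue)] -/
theorem le_chartMeasure_restrict {r : ℝ} (hr : 0 < r) (hr2 : r ≤ 1 / 2) {B : Set (𝔼 N)}
    (hB : B ⊆ closedBall 0 r) :
    lowerConst N r • (volume : Measure (𝔼 N)).restrict B ≤ (chartMeasure N).restrict B := by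
  refine Measure.le_iff.2 fun s hs => ?_
  rw [Measure.restrict_apply hs, Measure.smul_apply, smul_eq_mul, Measure.restrict_apply hs]
  exact le_chartMeasure_of_subset hr hr2 (inter_subset_right.trans hB)

/-- Transfer of integrals: `∫_{chart(B)} f dσ = ∫_B f ∘ chart dν`. [folklore] -/
theorem lintegral_image_chart (B : Set (𝔼 N)) (f : 𝔾 N → ℝ≥0∞) :
    ∫⁻ U in chart '' B, f U ∂haarProbability (𝔾 N) = ∫⁻ a in B, f (chart a) ∂chartMeasure N := by
  have he := measurableEmbedding_chart (N := N)
  have h1 : (chartMeasure N).restrict B = Measure.comap chart ((haarProbability (𝔾 N)).restrict (chart '' B)) := by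
    rw [chartMeasure, he.comap_restrict, preimage_image_eq _ he.injective]
  rw [h1, ← he.lintegral_map, he.map_comap, Measure.restrict_restrict he.measurableSet_range,
    inter_eq_self_of_subset_right (image_subset_range _ _)]

/-- **Upper bound for integrals near the identity** (Chatterjee arXiv:1602.01222 Thm. 11.1,
upper half, soft constant): for `f ≥ 0` and any `B`,
`∫_{chart(B)} f dσ ≤ c_N ∫_B f(chart a) da`. [cite: arXiv160201222, Thm. 11.1 (analogue)] -/
theorem lintegral_image_chart_le (B : Set (𝔼 N)) (f : 𝔾 N → ℝ≥0∞) :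
    ∫⁻ U in chart '' B, f U ∂haarProbability (𝔾 N) ≤
      haarChartConst N * ∫⁻ a in B, f (chart a) := by
  rw [lintegral_image_chart]
  calc ∫⁻ a in B, f (chart a) ∂chartMeasure N
      ≤ ∫⁻ a, f (chart a) ∂(haarChartConst N • (volume : Measure (𝔼 N)).restrict B) :=
        lintegral_mono' (chartMeasure_restrict_le B) le_rfl
    _ = haarChartConst N * ∫⁻ a in B, f (chart a) := by
        rw [lintegral_smul_measure]; rfl

/-- **Lower bound for integrals near the identity** (Chatterjee arXiv:1602.01222 Thm. 11.1,
lower half, soft constant): for `f ≥ 0` and `0 < r ≤ 1/2`,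
`c_N κ(r)^{-N²} ∫_{b(0,r)} f(chart a) da ≤ ∫_{chart(b(0,r))} f dσ`. [cite: arXiv160201222, Thm. 11.1 (analogue)] -/
theorem le_lintegral_image_chart {r : ℝ} (hr : 0 < r) (hr2 : r ≤ 1 / 2) (f : 𝔾 N → ℝ≥0∞) :
    lowerConst N r * ∫⁻ a in closedBall 0 r, f (chart a) ≤
      ∫⁻ U in chart '' closedBall 0 r, f U ∂haarProbability (𝔾 N) := by
  rw [lintegral_image_chart]
  calc lowerConst N r * ∫⁻ a in closedBall 0 r, f (chart a)
      = ∫⁻ a, f (chart a) ∂(lowerConst N r • (volume : Measure (𝔼 N)).restrict (closedBall 0 r)) := by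
        rw [lintegral_smul_measure, smul_eq_mul]
    _ ≤ ∫⁻ a in closedBall 0 r, f (chart a) ∂chartMeasure N :=
        lintegral_mono' (le_chartMeasure_restrict hr hr2 Subset.rfl) le_rfl

/-- The chart image of `b(0, r)` sits between the group balls `B(1, r/κ(r))` and `B(1, r)`
(Chatterjee arXiv:1602.01222 Cor. 11.3 / eq. (11.x) `ψ(b(0,r)) ⊆ B(I,2r) ⊆ ψ(b(0,3r))`,
for the Cayley chart). [cite: arXiv160201222, Cor. 11.3] -/
theorem gball_subset_image_chart {r : ℝ} (hr : 0 ≤ r) (hr2 : r ≤ 1 / 2) :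
    gball N (r / κ r) ⊆ chart '' closedBall (0 : 𝔼 N) r := by
  have h := setOf_norm_sub_le_subset_image_chart (N := N) hr2 (a := 0) (by simpa using hr) hr le_rfl
  intro U hU
  refine h ?_
  rw [mem_setOf_eq, chart_zero, OneMemClass.coe_one]
  exact hU

/-- `chart(b(0, r)) ⊆ B(1, r)`. [cite: arXiv160201222, Cor. 11.3] -/
theorem image_chart_subset_gball (r : ℝ) : chart '' closedBall (0 : 𝔼 N) r ⊆ gball N r := by
  intro U hU
  have h := image_chart_closedBall_subset (N := N) 0 r hU
  rw [mem_setOf_eq, chart_zero, OneMemClass.coe_one] at h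
  exact h

/-- Chart images of measurable sets are measurable. [folklore] -/
theorem measurableSet_image_chart {B : Set (𝔼 N)} (hB : MeasurableSet B) :
    MeasurableSet (chart '' B) :=
  measurableEmbedding_chart.measurableSet_image.2 hB

/-- **Small balls have Haar measure `≥ (C δ)^{N²}`** (Chatterjee arXiv:1602.01222 Cor. 6.3,
lower bound, with a soft constant): there is `C₁ > 0` with `σ(B(1,δ)) ≥ C₁ δ^{N²}` for all
`0 < δ ≤ 1`. [cite: arXiv160201222, Cor. 6.3] -/
theorem exists_haar_gball_ge :
    ∃ C : ℝ, 0 < C ∧ ∀ δ : ℝ, 0 < δ → δ ≤ 1 →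
      ENNReal.ofReal (C * δ ^ (N * N)) ≤ haarProbability (𝔾 N) (gball N δ) := by
  -- near `0`: `g(δ) ≥ c/2`, i.e. `σ(B(1,δ)) ≥ (c/2) vol(b(0,1)) δ^{N²}`
  have hc := haarChartConst_pos (N := N)
  have hev : ∀ᶠ δ in 𝓝[>] (0 : ℝ), ((haarChartConst N / 2 : ℝ≥0) : ℝ≥0∞) < ballRatio N δ :=
    tendsto_ballRatio.eventually_const_lt (by exact_mod_cast half_lt_self hc)
  obtain ⟨δ₀, hδ₀, hδ₀P⟩ : ∃ δ₀ > 0, ∀ δ, 0 < δ → δ ≤ δ₀ →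
      ((haarChartConst N / 2 : ℝ≥0) : ℝ≥0∞) < ballRatio N δ := by
    rw [eventually_nhdsWithin_iff, Metric.eventually_nhds_iff] at hev
    obtain ⟨ε, hε, h⟩ := hev
    refine ⟨ε / 2, half_pos hε, fun δ hδ hδε => h ?_ hδ⟩
    rw [Real.dist_eq, sub_zero, abs_of_pos hδ]; linarith
  set V₁ := volume (closedBall (0 : 𝔼 N) 1) with hV₁
  have hV₁fin : V₁ ≠ ∞ := (volume_closedBall_𝔼_lt_top _ _).ne
  have hV₁pos : V₁ ≠ 0 := (volume_closedBall_𝔼_pos _ one_pos).ne'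
  -- the constant
  set C : ℝ := (haarChartConst N / 2 : ℝ≥0) * V₁.toReal * (min δ₀ 1) ^ (N * N) with hC
  have hCpos : 0 < C := by
    have : 0 < V₁.toReal := ENNReal.toReal_pos hV₁pos hV₁fin
    have : (0 : ℝ) < (haarChartConst N / 2 : ℝ≥0) := by exact_mod_cast half_pos hc
    positivity
  refine ⟨C, hCpos, fun δ hδ hδ1 => ?_⟩
  -- reduce to the radius `δ' = min δ₀ 1 * δ ≤ δ₀`
  set δ' := min δ₀ 1 * δ with hδ'
  have hm0 : 0 < min δ₀ 1 := lt_min hδ₀ one_pos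
  have hδ'pos : 0 < δ' := mul_pos hm0 hδ
  have hδ'le : δ' ≤ δ₀ := by
    rw [hδ']
    calc min δ₀ 1 * δ ≤ min δ₀ 1 * 1 := mul_le_mul_of_nonneg_left hδ1 hm0.le
      _ ≤ δ₀ := by rw [mul_one]; exact min_le_left _ _
  have hδ'δ : δ' ≤ δ := by
    rw [hδ']
    calc min δ₀ 1 * δ ≤ 1 * δ := mul_le_mul_of_nonneg_right (min_le_right _ _) hδ.le
      _ = δ := one_mul δ
  have h1 := (hδ₀P δ' hδ'pos hδ'le).le
  rw [ballRatio, ENNReal.le_div_iff_mul_le (Or.inl (volume_closedBall_𝔼_pos _ hδ'pos).ne')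
    (Or.inl (volume_closedBall_𝔼_lt_top _ _).ne), volume_closedBall_𝔼 _ hδ'pos.le] at h1
  refine le_trans ?_ (h1.trans (measure_mono (gball_mono hδ'δ)))
  rw [hC, hδ', mul_pow, ← hV₁]
  have e : ENNReal.ofReal ((haarChartConst N / 2 : ℝ≥0) * V₁.toReal * min δ₀ 1 ^ (N * N) * δ ^ (N * N))
      = ((haarChartConst N / 2 : ℝ≥0) : ℝ≥0∞) *
        (ENNReal.ofReal (min δ₀ 1 ^ (N * N) * δ ^ (N * N)) * V₁) := by
    rw [show ((haarChartConst N / 2 : ℝ≥0) : ℝ) * V₁.toReal * min δ₀ 1 ^ (N * N) * δ ^ (N * N) =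
        (haarChartConst N / 2 : ℝ≥0) * ((min δ₀ 1 ^ (N * N) * δ ^ (N * N)) * V₁.toReal) by ring,
      ENNReal.ofReal_mul (by positivity), ENNReal.ofReal_coe_nnreal,
      ENNReal.ofReal_mul (by positivity), ENNReal.ofReal_toReal hV₁fin]
  rw [e]

end Comparison

/-! ### Product version: finitely many independent Haar factors -/

section Pi

open MeasureTheory Measure Metric Filter Topology Set Function
open scoped ENNReal NNReal Topology

/-- Monotonicity of finite product measures (over `Fin n`). [folklore] -/
theorem pi_mono_fin {X : Type*} [MeasurableSpace X] :
    ∀ (n : ℕ) (μ μ' : Fin n → Measure X) [∀ i, SigmaFinite (μ i)] [∀ i, SigmaFinite (μ' i)],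
      (∀ i, μ i ≤ μ' i) → Measure.pi μ ≤ Measure.pi μ'
  | 0, μ, μ', _, _, _ => by rw [Measure.pi_of_empty, Measure.pi_of_empty]
  | n + 1, μ, μ', _, _, h => by
    have e := (measurePreserving_piFinSuccAbove μ 0).symm
    have e' := (measurePreserving_piFinSuccAbove μ' 0).symm
    rw [← e.map_eq, ← e'.map_eq]
    refine Measure.map_mono ?_ (MeasurableEquiv.measurable _)
    exact Measure.prod_mono (h 0) (pi_mono_fin n _ _ fun j => h _)

/-- Monotonicity of finite product measures. [folklore] -/
theorem pi_mono {ι X : Type*} [Fintype ι] [MeasurableSpace X] (μ μ' : ι → Measure X)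
    [∀ i, SigmaFinite (μ i)] [∀ i, SigmaFinite (μ' i)] (h : ∀ i, μ i ≤ μ' i) :
    Measure.pi μ ≤ Measure.pi μ' := by
  set f := (Fintype.equivFin ι).symm
  have e := measurePreserving_piCongrLeft (α := fun _ : ι => X) μ f
  have e' := measurePreserving_piCongrLeft (α := fun _ : ι => X) μ' f
  rw [← e.map_eq, ← e'.map_eq]
  refine Measure.map_mono ?_ (MeasurableEquiv.measurable _)
  exact pi_mono_fin _ _ _ fun i => h _

/-- Scalars pull out of finite product measures: `⨂ (c μ_i) = c^{#ι} ⨂ μ_i`. [folklore] -/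
theorem pi_const_smul {ι X : Type*} [Fintype ι] [MeasurableSpace X] (μ : ι → Measure X)
    [∀ i, SigmaFinite (μ i)] (c : ℝ≥0) :
    Measure.pi (fun i => c • μ i) = (c ^ Fintype.card ι) • Measure.pi μ := by
  refine Measure.pi_eq fun s _ => ?_
  rw [Measure.coe_nnreal_smul_apply, Measure.pi_pi]
  simp only [Measure.coe_nnreal_smul_apply]
  rw [Finset.prod_mul_distrib, Finset.prod_const, Finset.card_univ, ENNReal.coe_pow]

variable {ι : Type*}

/-- The chart applied coordinatewise. [folklore] -/
def chartPi (a : ι → 𝔼 N) : ι → 𝔾 N := fun i => chart (a i)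

/-- Coordinates of `chartPi a`. [folklore] -/
@[simp] theorem chartPi_apply (a : ι → 𝔼 N) (i : ι) : chartPi a i = chart (a i) := rfl

/-- `chartPi` is measurable. [folklore] -/
theorem measurable_chartPi : Measurable (chartPi (N := N) (ι := ι)) :=
  measurable_pi_lambda _ fun i => continuous_chart.measurable.comp (measurable_pi_apply i)

variable [Fintype ι]

/-- `σ|_{chart(B)} = chart_* (ν|_B)`. [folklore] -/
theorem haar_restrict_image_chart (B : Set (𝔼 N)) :
    (haarProbability (𝔾 N)).restrict (chart '' B) = Measure.map chart ((chartMeasure N).restrict B) := by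
  have he := measurableEmbedding_chart (N := N)
  have h1 : (chartMeasure N).restrict B =
      Measure.comap chart ((haarProbability (𝔾 N)).restrict (chart '' B)) := by
    rw [chartMeasure, he.comap_restrict, preimage_image_eq _ he.injective]
  rw [h1, he.map_comap, Measure.restrict_restrict he.measurableSet_range,
    inter_eq_self_of_subset_right (image_subset_range _ _)]

/-- The product Haar measure restricted to a product of chart images is the image of the
product of the chart measures. [folklore] -/
theorem pi_haar_restrict_image_chart (B : Set (𝔼 N)) :
    (Measure.pi fun _ : ι => haarProbability (𝔾 N)).restrict (Set.pi univ fun _ => chart '' B) =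
      Measure.map chartPi (Measure.pi fun _ : ι => (chartMeasure N).restrict B) := by
  rw [Measure.restrict_pi_pi]
  simp only [haar_restrict_image_chart]
  rw [← Measure.pi_map_pi fun _ => continuous_chart.aemeasurable]
  rfl

/-- Transfer of product integrals to the chart. [folklore] -/
theorem lintegral_pi_image_chart (B : Set (𝔼 N)) {F : (ι → 𝔾 N) → ℝ≥0∞} (hF : Measurable F) :
    ∫⁻ U in Set.pi univ (fun _ => chart '' B), F U ∂(Measure.pi fun _ : ι => haarProbability (𝔾 N)) =
      ∫⁻ a, F (chartPi a) ∂(Measure.pi fun _ : ι => (chartMeasure N).restrict B) := by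
  rw [pi_haar_restrict_image_chart, lintegral_map hF measurable_chartPi]

/-- **Upper bound for product integrals near the identity**: for measurable `F ≥ 0` on
`U(N)^ι` and any `B ⊆ ℝ^{N²}`,
`∫_{chart(B)^ι} F dσ^{⊗ι} ≤ c_N^{#ι} ∫_{B^ι} F(chart ∘ a) da` (Chatterjee arXiv:1602.01222
Thm. 11.1, second assertion, upper half, soft constant). [cite: arXiv160201222, Thm. 11.1 (analogue)] -/
theorem lintegral_pi_image_chart_le (B : Set (𝔼 N)) {F : (ι → 𝔾 N) → ℝ≥0∞} (hF : Measurable F) :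
    ∫⁻ U in Set.pi univ (fun _ => chart '' B), F U ∂(Measure.pi fun _ : ι => haarProbability (𝔾 N)) ≤
      (haarChartConst N : ℝ≥0∞) ^ Fintype.card ι *
        ∫⁻ a in Set.pi univ (fun _ => B), F (chartPi a) := by
  rw [lintegral_pi_image_chart B hF]
  calc ∫⁻ a, F (chartPi a) ∂(Measure.pi fun _ : ι => (chartMeasure N).restrict B)
      ≤ ∫⁻ a, F (chartPi a) ∂(Measure.pi fun _ : ι =>
          haarChartConst N • (volume : Measure (𝔼 N)).restrict B) :=
        lintegral_mono' (pi_mono _ _ fun _ => chartMeasure_restrict_le B) le_rfl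
    _ = (haarChartConst N : ℝ≥0∞) ^ Fintype.card ι * ∫⁻ a in Set.pi univ (fun _ => B), F (chartPi a) := by
        rw [pi_const_smul, lintegral_smul_measure, volume_pi, ← Measure.restrict_pi_pi]
        rfl

/-- **Lower bound for product integrals near the identity**: for measurable `F ≥ 0` on
`U(N)^ι` and `0 < r ≤ 1/2`,
`(c_N κ(r)^{-N²})^{#ι} ∫_{b(0,r)^ι} F(chart ∘ a) da ≤ ∫_{chart(b(0,r))^ι} F dσ^{⊗ι}`
(Chatterjee arXiv:1602.01222 Thm. 11.1, second assertion, lower half, soft constant). [cite: arXiv160201222, Thm. 11.1 (analogue)] -/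
theorem le_lintegral_pi_image_chart {r : ℝ} (hr : 0 < r) (hr2 : r ≤ 1 / 2) {F : (ι → 𝔾 N) → ℝ≥0∞}
    (hF : Measurable F) :
    lowerConst N r ^ Fintype.card ι * ∫⁻ a in Set.pi univ (fun _ => closedBall (0 : 𝔼 N) r), F (chartPi a) ≤
      ∫⁻ U in Set.pi univ (fun _ => chart '' closedBall (0 : 𝔼 N) r), F U
        ∂(Measure.pi fun _ : ι => haarProbability (𝔾 N)) := by
  rw [lintegral_pi_image_chart _ hF]
  set l : ℝ≥0 := (lowerConst N r).toNNReal with hl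
  have hll : (l : ℝ≥0∞) = lowerConst N r := ENNReal.coe_toNNReal (lowerConst_ne_top r hr.le)
  calc lowerConst N r ^ Fintype.card ι * ∫⁻ a in Set.pi univ (fun _ => closedBall (0 : 𝔼 N) r), F (chartPi a)
      = ∫⁻ a, F (chartPi a) ∂(Measure.pi fun _ : ι => l • (volume : Measure (𝔼 N)).restrict (closedBall 0 r)) := by
        rw [pi_const_smul, lintegral_smul_measure, volume_pi, ← Measure.restrict_pi_pi, ← hll]
        rfl
    _ ≤ ∫⁻ a, F (chartPi a) ∂(Measure.pi fun _ : ι => (chartMeasure N).restrict (closedBall 0 r)) := by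
        refine lintegral_mono' (pi_mono _ _ fun _ => ?_) le_rfl
        have h := le_chartMeasure_restrict (N := N) hr hr2 (B := closedBall 0 r) Subset.rfl
        rwa [← hll] at h

end Pi

/-! ### Hilbert–Schmidt geometry of `U(N)` (Chatterjee §7) and the Taylor expansion of the chart -/

section Geometry

/-- **Lemma 7.2**: `Re tr(1 - U) = ½ ‖1 - U‖²` for unitary `U`. [cite: arXiv160201222, Lemma 7.2] -/
theorem re_trace_one_sub {U : 𝕄} (hU : U ∈ Matrix.unitaryGroup (Fin N) ℂ) :
    (Matrix.trace (1 - U)).re = ‖1 - U‖ ^ 2 / 2 := by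
  have h1 : Uᴴ * U = 1 := by
    rw [← star_eq_conjTranspose]; exact Matrix.mem_unitaryGroup_iff'.1 hU
  have e : (1 - U)ᴴ * (1 - U) = (1 - U) + (1 - U)ᴴ := by
    rw [conjTranspose_sub, conjTranspose_one, Matrix.sub_mul, Matrix.mul_sub, Matrix.mul_sub, h1,
      Matrix.one_mul, Matrix.mul_one, Matrix.one_mul]
    abel
  rw [Matrix.frobenius_norm_sq_eq_re_trace, e, Matrix.trace_add, map_add, Matrix.trace_conjTranspose,
    RCLike.star_def, RCLike.conj_re]
  simp only [RCLike.re_to_complex]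
  ring

/-- **Lemma 7.5**: `‖1 - U⁻¹‖ = ‖1 - U‖` for unitary `U`. [cite: arXiv160201222, Lemma 7.5] -/
theorem norm_one_sub_inv (U : 𝔾 N) : ‖(1 : 𝕄) - ((U⁻¹ : 𝔾 N) : 𝕄)‖ = ‖(1 : 𝕄) - U‖ := by
  have e : (1 : 𝕄) - ((U⁻¹ : 𝔾 N) : 𝕄) = ((U⁻¹ : 𝔾 N) : 𝕄) * ((U : 𝕄) - 1) := by
    rw [Matrix.mul_sub, Matrix.mul_one, ← Submonoid.coe_mul, inv_mul_cancel]; rfl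
  rw [e, Matrix.frobenius_norm_unitaryGroup_mul, ← norm_neg, neg_sub]

/-- **Lemma 7.4** (two factors): `‖1 - U V‖ ≤ ‖1 - U‖ + ‖1 - V‖` for `U` unitary. [cite: arXiv160201222, Lemma 7.4] -/
theorem norm_one_sub_mul_le (U : 𝔾 N) (V : 𝕄) :
    ‖(1 : 𝕄) - (U : 𝕄) * V‖ ≤ ‖(1 : 𝕄) - U‖ + ‖(1 : 𝕄) - V‖ := by
  have e : (1 : 𝕄) - (U : 𝕄) * V = ((1 : 𝕄) - U) + (U : 𝕄) * (1 - V) := by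
    rw [Matrix.mul_sub, Matrix.mul_one]; abel
  rw [e]
  exact (norm_add_le _ _).trans (by rw [Matrix.frobenius_norm_unitaryGroup_mul])

/-- **Lemma 7.4** (lists): `‖1 - U₁ ⋯ U_m‖ ≤ Σ ‖1 - U_j‖`. [cite: arXiv160201222, Lemma 7.4] -/
theorem norm_one_sub_prod_le (l : List (𝔾 N)) :
    ‖(1 : 𝕄) - ((l.prod : 𝔾 N) : 𝕄)‖ ≤ (l.map fun U : 𝔾 N => ‖(1 : 𝕄) - U‖).sum := by
  induction l with
  | nil => simp
  | cons U l ih =>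
    rw [List.prod_cons, List.map_cons, List.sum_cons, Submonoid.coe_mul]
    exact (norm_one_sub_mul_le U _).trans (by gcongr)

/-- The norm of a plaquette-type word: `‖1 - U₁ U₂ U₃⁻¹ U₄⁻¹‖ ≤ Σᵢ ‖1 - Uᵢ‖`
(Chatterjee arXiv:1602.01222, proof of Thm. 7.1). [cite: arXiv160201222, Lemma 7.4] -/
theorem norm_one_sub_plaquetteWord_le (U₁ U₂ U₃ U₄ : 𝔾 N) :
    ‖(1 : 𝕄) - ((U₁ * U₂ * U₃⁻¹ * U₄⁻¹ : 𝔾 N) : 𝕄)‖ ≤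
      ‖(1 : 𝕄) - U₁‖ + ‖(1 : 𝕄) - U₂‖ + ‖(1 : 𝕄) - U₃‖ + ‖(1 : 𝕄) - U₄‖ := by
  have h := norm_one_sub_prod_le [U₁, U₂, U₃⁻¹, U₄⁻¹]
  simp only [List.prod_cons, List.prod_nil, mul_one, List.map_cons, List.map_nil, List.sum_cons,
    List.sum_nil, add_zero, norm_one_sub_inv] at h
  simpa only [mul_assoc, add_assoc] using h

/-- **Taylor expansion of the Cayley transform**: `2 cay X = (2 + 2X + X²) + X³ (2 - X)⁻¹`
(exact), for skew-Hermitian `X`; i.e. `cay X = 1 + X + X²/2 + O(X³)` agrees to second order with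
`e^{X}` (Chatterjee arXiv:1602.01222 Lemma 16.1 expands `e^{iH}`). [cite: arXiv160201222, Lemma 16.1 (analogue)] -/
theorem two_smul_cay {X : 𝕄} (hX : Xᴴ = -X) :
    (2 : ℂ) • cay X = (2 + 2 * X + X * X) + X * X * X * (2 - X)⁻¹ := by
  have hu := (isUnit_iff_isUnit_det _).1 (isUnit_two_sub hX)
  have key : ((2 : 𝕄) + 2 * X + X * X) * (2 - X) + X * X * X = 2 * (2 + X) := by noncomm_ring
  rw [cay, two_smul, ← two_mul, ← Matrix.mul_assoc, ← key, Matrix.add_mul,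
    Matrix.mul_nonsing_inv_cancel_right (2 - X) _ hu]

/-- The Taylor remainder of the chart is cubic: `‖cay X - (1 + X + X²/2)‖ ≤ ‖X‖³/4`. [cite: arXiv160201222, Lemma 16.1 (analogue)] -/
theorem norm_cay_sub_taylor_le {X : 𝕄} (hX : Xᴴ = -X) :
    ‖cay X - (1 + X + (2 : ℂ)⁻¹ • (X * X))‖ ≤ ‖X‖ ^ 3 / 4 := by
  have hu := (isUnit_iff_isUnit_det _).1 (isUnit_two_sub hX)
  have h : (2 : ℂ) • (cay X - (1 + X + (2 : ℂ)⁻¹ • (X * X))) = X * X * X * (2 - X)⁻¹ := by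
    rw [smul_sub, two_smul_cay hX, smul_add, smul_add, smul_smul, mul_inv_cancel₀ two_ne_zero,
      one_smul, two_smul, two_smul, one_add_one_eq_two, ← two_mul]
    abel
  have h1 : ‖X * X * X * (2 - X)⁻¹‖ ≤ ‖X‖ ^ 3 / 2 := by
    have h' := two_mul_norm_le_norm_mul_two_sub hX (X * X * X * (2 - X)⁻¹)
    rw [Matrix.nonsing_inv_mul_cancel_right (2 - X) _ hu] at h'
    have h3 : ‖X * X * X‖ ≤ ‖X‖ ^ 3 := by
      calc ‖X * X * X‖ ≤ ‖X * X‖ * ‖X‖ := Matrix.frobenius_norm_mul _ _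
        _ ≤ ‖X‖ * ‖X‖ * ‖X‖ := by gcongr; exact Matrix.frobenius_norm_mul _ _
        _ = ‖X‖ ^ 3 := by ring
    linarith
  have h2 : ‖(2 : ℂ) • (cay X - (1 + X + (2 : ℂ)⁻¹ • (X * X)))‖ =
      2 * ‖cay X - (1 + X + (2 : ℂ)⁻¹ • (X * X))‖ := by
    rw [norm_smul]; norm_num
  rw [h] at h2
  linarith

end Geometry

end UnitaryCayley

end Literature.MathematicalPhysics.QuantumFieldTheory
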